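import Literature.Analysis.FluidPDE.LocalLerayCrossBulkPairings
import HarnessLib

/-!
# The bulk terms of the `u₁ · u₂` balance: integrability and the limit in the time doubling

Analysis/FluidPDE theorem file (no definitions). Weak–strong uniqueness for local Leray
solutions (Lemarié-Rieusset 2016, Thm. 14.7, proof p. 515): the balance equation for `u₁ · u₂`
is obtained by doubling the time variable (Serrin 1963, §4). With the densities
`f(σ,s)` (the equation of `u₁` at time `s` tested with `ψ u₂(σ)`) and `g(s,σ)` (the equation of
`u₂` at time `σ` tested with `ψ u₁(s)`) furnished by the accepted
`IsLocalLeraySolutionOn.ae_pairing_smul_eq_datum_add`, the doubling identity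
(`FunctionSpaces.doubling_identity_compact`) involves `∫∫ ρₙ(s-σ) χ(s) (f(σ,s) + g(s,σ)) dσ ds`,
and one must pass to the limit `n → ∞`. This file proves:

* `cross_density_f_eq`, `cross_density_g_eq` — the slice identities rewriting the densities as
  finite sums of pairings `∫_K ⟪a(s,x), b(σ,x)⟫ dx` over `K = supp ψ` (moving `ψ`, `∇ψ` onto the
  factors, expanding `∑ᵢ ∂ᵢψ G eᵢ = G ∇ψ`, splitting `u₁ = u₃ + (u₁ - u₃)`);
* `integrable_cross_density_f/g` (joint integrability on `(0,T)²`),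
  `integrableOn_cross_density_f/g_diag` (integrability of the diagonal `s ↦ f(s,s)`, `g(s,s)`);
* `tendsto_cross_bulk` — **the limit**:
  `∫∫ ρₙ(s-σ) χ(s) (f(σ,s) + g(s,σ)) dσ ds → ∫ χ(s) (f(s,s) + g(s,s)) ds`, for every continuous
  cut-off `χ` supported in `[δ, T-δ]`, from the nine atomic pairings of
  `LocalLerayCrossBulkPairings` and the packages `FunctionSpaces.doubledPairing_package_of_ae_le`
  / `_of_rpow` (the term `⟪G₂(u₂), ψ u₁⟫` through `doubledPairing_swap` and
  `doubledPairing_insert_cutoff`).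

The regularity of `u₁` (`u₁ = u₃ + u₄`, `u₃ ∈ L²_t L^∞_x`, `u₄ ∈ L^∞_t L³_x` small) is exactly what
makes every pairing fall into a pair of dual mixed Lebesgue spaces (Lemarié-Rieusset 2016,
p. 515: "since `u₁` is regular enough, we may write …").

## References

* P. G. Lemarié-Rieusset, *The Navier–Stokes Problem in the 21st Century*, CRC Press 2016,
  doi:10.1201/b19556, Thm. 14.7, proof p. 515. [LemarieRieusset2016]
* J. Serrin, in: Nonlinear Problems (Madison 1962), 1963, §4. [Serrin1963]
-/

noncomputable section

open MeasureTheory TopologicalSpace Set Function Filter Metric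
open _root_.Topology
open scoped ENNReal NNReal RealInnerProductSpace

namespace Literature.Analysis.FluidPDE

open FunctionSpaces

/-! ## Pointwise and slice identities -/

section SliceIdentities

variable {ψ : EuclideanSpace ℝ (Fin 3) → ℝ}

/-- `∑ᵢ ∂ᵢψ(x) eᵢ = ∇ψ(x)` in the standard orthonormal basis. [folklore] -/
theorem sum_fderiv_smul_stdOrthonormalBasis (ψ : EuclideanSpace ℝ (Fin 3) → ℝ) (x : EuclideanSpace ℝ (Fin 3)) :
    ∑ i, fderiv ℝ ψ x (stdOrthonormalBasis ℝ (EuclideanSpace ℝ (Fin 3)) i) •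
      stdOrthonormalBasis ℝ (EuclideanSpace ℝ (Fin 3)) i = gradient ψ x := by
  conv_rhs => rw [← (stdOrthonormalBasis ℝ (EuclideanSpace ℝ (Fin 3))).sum_repr' (gradient ψ x)]
  refine Finset.sum_congr rfl fun i _ => ?_
  rw [real_inner_comm, inner_gradient_left]

/-- **The pointwise identity behind the third bulk term** (`L = ∇u₁`, `M = ∇u₂`, `v = u₂`):
`∑ᵢ ⟪L eᵢ, ∂ᵢψ v + ψ M eᵢ⟫ = ⟪L ∇ψ, v⟫ + ∑ᵢ ⟪L (ψ eᵢ), M eᵢ⟫`. [folklore] -/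
theorem sum_inner_apply_basis_eq (ψ : EuclideanSpace ℝ (Fin 3) → ℝ) (x : EuclideanSpace ℝ (Fin 3))
    (L M : EuclideanSpace ℝ (Fin 3) →L[ℝ] EuclideanSpace ℝ (Fin 3)) (v : EuclideanSpace ℝ (Fin 3)) :
    ∑ i, ⟪L (stdOrthonormalBasis ℝ (EuclideanSpace ℝ (Fin 3)) i),
        fderiv ℝ ψ x (stdOrthonormalBasis ℝ (EuclideanSpace ℝ (Fin 3)) i) • v +
          ψ x • M (stdOrthonormalBasis ℝ (EuclideanSpace ℝ (Fin 3)) i)⟫ =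
      ⟪L (gradient ψ x), v⟫ + ∑ i, ⟪L (ψ x • stdOrthonormalBasis ℝ (EuclideanSpace ℝ (Fin 3)) i),
        M (stdOrthonormalBasis ℝ (EuclideanSpace ℝ (Fin 3)) i)⟫ := by
  set e := stdOrthonormalBasis ℝ (EuclideanSpace ℝ (Fin 3)) with he
  simp only [inner_add_right, Finset.sum_add_distrib]
  congr 1
  · rw [← sum_fderiv_smul_stdOrthonormalBasis ψ x, map_sum, sum_inner]
    refine Finset.sum_congr rfl fun i _ => ?_
    rw [map_smul, real_inner_smul_left, real_inner_smul_right]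
  · refine Finset.sum_congr rfl fun i _ => ?_
    rw [map_smul, real_inner_smul_left, real_inner_smul_right]

/-- The same identity seen from the second solution (`M = ∇u₂` acting, `L = ∇u₁`, `v = u₁`):
`∑ᵢ ⟪M eᵢ, ∂ᵢψ v + ψ L eᵢ⟫ = ⟪v, M ∇ψ⟫ + ∑ᵢ ⟪L (ψ eᵢ), M eᵢ⟫`. [folklore] -/
theorem sum_inner_apply_basis_eq' (ψ : EuclideanSpace ℝ (Fin 3) → ℝ) (x : EuclideanSpace ℝ (Fin 3))
    (L M : EuclideanSpace ℝ (Fin 3) →L[ℝ] EuclideanSpace ℝ (Fin 3)) (v : EuclideanSpace ℝ (Fin 3)) :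
    ∑ i, ⟪M (stdOrthonormalBasis ℝ (EuclideanSpace ℝ (Fin 3)) i),
        fderiv ℝ ψ x (stdOrthonormalBasis ℝ (EuclideanSpace ℝ (Fin 3)) i) • v +
          ψ x • L (stdOrthonormalBasis ℝ (EuclideanSpace ℝ (Fin 3)) i)⟫ =
      ⟪v, M (gradient ψ x)⟫ + ∑ i, ⟪L (ψ x • stdOrthonormalBasis ℝ (EuclideanSpace ℝ (Fin 3)) i),
        M (stdOrthonormalBasis ℝ (EuclideanSpace ℝ (Fin 3)) i)⟫ := by
  rw [sum_inner_apply_basis_eq ψ x M L v, real_inner_comm]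
  congr 1
  refine Finset.sum_congr rfl fun i _ => ?_
  rw [map_smul, map_smul, real_inner_smul_left, real_inner_smul_left, real_inner_comm]

/-- Support facts: off `K = tsupport ψ`, `ψ`, `∇ψ` and `Dψ` vanish (any `ψ`). [folklore] -/
theorem testFunction_vanish {x : EuclideanSpace ℝ (Fin 3)} (hx : x ∉ tsupport ψ) :
    ψ x = 0 ∧ gradient ψ x = 0 ∧ fderiv ℝ ψ x = 0 := by
  refine ⟨image_eq_zero_of_notMem_tsupport hx, ?_, fderiv_of_notMem_tsupport ℝ hx⟩
  simp [gradient, fderiv_of_notMem_tsupport ℝ hx]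

/-- **The `u₁`-density as a sum of pairings.** For fixed slices `Gs = ∇u₁(s)`, `us = u₁(s)`,
`vs = u₃(s)`, `ps = p₁(s)`, `ws = u₂(σ)`, `Bs = ∇u₂(σ)`, the density of the pairing identity of
`u₁` tested with `ψ ws` equals
`-(∫_K ⟪ψ Gs vs, ws⟫ + ∫_K ⟪ψ Gs (us - vs), ws⟫) + ∫_K ⟪ps ∇ψ, ws⟫ - ν (∫_K ⟪Gs ∇ψ, ws⟫ + ∑ᵢ ∫_K ⟪Gs (ψ eᵢ), Bs eᵢ⟫)`,
`K = supp ψ`, provided the four pairings are integrable on `K`. [folklore] -/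
theorem cross_density_f_eq
    {Gs Bs : EuclideanSpace ℝ (Fin 3) → EuclideanSpace ℝ (Fin 3) →L[ℝ] EuclideanSpace ℝ (Fin 3)}
    {us vs ws : EuclideanSpace ℝ (Fin 3) → EuclideanSpace ℝ (Fin 3)} {ps : EuclideanSpace ℝ (Fin 3) → ℝ} (ν : ℝ)
    (i1 : Integrable (fun x => ⟪ψ x • Gs x (vs x), ws x⟫) (volume.restrict (tsupport ψ)))
    (i2 : Integrable (fun x => ⟪ψ x • Gs x (us x - vs x), ws x⟫) (volume.restrict (tsupport ψ)))
    (i3 : Integrable (fun x => ⟪Gs x (gradient ψ x), ws x⟫) (volume.restrict (tsupport ψ)))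
    (i4 : ∀ i, Integrable (fun x => ⟪Gs x (ψ x • stdOrthonormalBasis ℝ (EuclideanSpace ℝ (Fin 3)) i),
      Bs x (stdOrthonormalBasis ℝ (EuclideanSpace ℝ (Fin 3)) i)⟫) (volume.restrict (tsupport ψ))) :
    ((-∫ x, ⟪Gs x (us x), ψ x • ws x⟫) + ∫ x, ps x * fderiv ℝ ψ x (ws x)) -
        ν * ∫ x, ∑ i, ⟪Gs x (stdOrthonormalBasis ℝ (EuclideanSpace ℝ (Fin 3)) i),
          fderiv ℝ ψ x (stdOrthonormalBasis ℝ (EuclideanSpace ℝ (Fin 3)) i) • ws x +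
            ψ x • Bs x (stdOrthonormalBasis ℝ (EuclideanSpace ℝ (Fin 3)) i)⟫ =
      ((-((∫ x in tsupport ψ, ⟪ψ x • Gs x (vs x), ws x⟫) + ∫ x in tsupport ψ, ⟪ψ x • Gs x (us x - vs x), ws x⟫)) +
          ∫ x in tsupport ψ, ⟪ps x • gradient ψ x, ws x⟫) -
        ν * ((∫ x in tsupport ψ, ⟪Gs x (gradient ψ x), ws x⟫) +
          ∑ i, ∫ x in tsupport ψ, ⟪Gs x (ψ x • stdOrthonormalBasis ℝ (EuclideanSpace ℝ (Fin 3)) i),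
            Bs x (stdOrthonormalBasis ℝ (EuclideanSpace ℝ (Fin 3)) i)⟫) := by
  set e := stdOrthonormalBasis ℝ (EuclideanSpace ℝ (Fin 3)) with he
  set K : Set (EuclideanSpace ℝ (Fin 3)) := tsupport ψ with hK
  have hv := fun x (hx : x ∉ K) => testFunction_vanish (ψ := ψ) hx
  -- term 1
  have h1 : ∫ x, ⟪Gs x (us x), ψ x • ws x⟫ =
      (∫ x in K, ⟪ψ x • Gs x (vs x), ws x⟫) + ∫ x in K, ⟪ψ x • Gs x (us x - vs x), ws x⟫ := by
    rw [← integral_add i1 i2, ← setIntegral_eq_integral_of_forall_compl_eq_zero (s := K)]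
    · refine integral_congr_ae (Eventually.of_forall fun x => ?_)
      simp only
      rw [real_inner_smul_right, real_inner_smul_left, real_inner_smul_left, ← mul_add, ← inner_add_left,
        ← map_add, add_sub_cancel]
    · intro x hx
      rw [(hv x hx).1, zero_smul, inner_zero_right]
  -- term 2
  have h2 : ∫ x, ps x * fderiv ℝ ψ x (ws x) = ∫ x in K, ⟪ps x • gradient ψ x, ws x⟫ := by
    rw [← setIntegral_eq_integral_of_forall_compl_eq_zero (s := K)]
    · refine integral_congr_ae (Eventually.of_forall fun x => ?_)
      simp only
      rw [real_inner_smul_left, inner_gradient_left]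
    · intro x hx
      simp [(hv x hx).2.2]
  -- term 3
  have h3 : ∫ x, ∑ i, ⟪Gs x (e i), fderiv ℝ ψ x (e i) • ws x + ψ x • Bs x (e i)⟫ =
      (∫ x in K, ⟪Gs x (gradient ψ x), ws x⟫) + ∑ i, ∫ x in K, ⟪Gs x (ψ x • e i), Bs x (e i)⟫ := by
    rw [← integral_finsetSum _ (fun i _ => i4 i), ← integral_add i3 (integrable_finsetSum _ fun i _ => i4 i),
      ← setIntegral_eq_integral_of_forall_compl_eq_zero (s := K)]
    · refine integral_congr_ae (Eventually.of_forall fun x => ?_)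
      simp only
      rw [sum_inner_apply_basis_eq]
    · intro x hx
      refine Finset.sum_eq_zero fun i _ => ?_
      simp [(hv x hx).1, (hv x hx).2.2]
  rw [h1, h2, h3]

/-- **The `u₂`-density as a sum of pairings**: for fixed slices as above (`Bs = ∇u₂(σ)`,
`ws = u₂(σ)`, `qs = p₂(σ)`, `us = u₁(s)`, `Gs = ∇u₁(s)`), the density of the pairing identity of
`u₂` tested with `ψ us` equals
`-∫_K ⟪us, ψ Bs ws⟫ + ∫_K ⟪us, qs ∇ψ⟫ - ν (∫_K ⟪us, Bs ∇ψ⟫ + ∑ᵢ ∫_K ⟪Gs (ψ eᵢ), Bs eᵢ⟫)`.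
[folklore] -/
theorem cross_density_g_eq
    {Gs Bs : EuclideanSpace ℝ (Fin 3) → EuclideanSpace ℝ (Fin 3) →L[ℝ] EuclideanSpace ℝ (Fin 3)}
    {us ws : EuclideanSpace ℝ (Fin 3) → EuclideanSpace ℝ (Fin 3)} {qs : EuclideanSpace ℝ (Fin 3) → ℝ} (ν : ℝ)
    (i3 : Integrable (fun x => ⟪us x, Bs x (gradient ψ x)⟫) (volume.restrict (tsupport ψ)))
    (i4 : ∀ i, Integrable (fun x => ⟪Gs x (ψ x • stdOrthonormalBasis ℝ (EuclideanSpace ℝ (Fin 3)) i),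
      Bs x (stdOrthonormalBasis ℝ (EuclideanSpace ℝ (Fin 3)) i)⟫) (volume.restrict (tsupport ψ))) :
    ((-∫ x, ⟪Bs x (ws x), ψ x • us x⟫) + ∫ x, qs x * fderiv ℝ ψ x (us x)) -
        ν * ∫ x, ∑ i, ⟪Bs x (stdOrthonormalBasis ℝ (EuclideanSpace ℝ (Fin 3)) i),
          fderiv ℝ ψ x (stdOrthonormalBasis ℝ (EuclideanSpace ℝ (Fin 3)) i) • us x +
            ψ x • Gs x (stdOrthonormalBasis ℝ (EuclideanSpace ℝ (Fin 3)) i)⟫ =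
      ((-(∫ x in tsupport ψ, ⟪us x, ψ x • Bs x (ws x)⟫)) + ∫ x in tsupport ψ, ⟪us x, qs x • gradient ψ x⟫) -
        ν * ((∫ x in tsupport ψ, ⟪us x, Bs x (gradient ψ x)⟫) +
          ∑ i, ∫ x in tsupport ψ, ⟪Gs x (ψ x • stdOrthonormalBasis ℝ (EuclideanSpace ℝ (Fin 3)) i),
            Bs x (stdOrthonormalBasis ℝ (EuclideanSpace ℝ (Fin 3)) i)⟫) := by
  set e := stdOrthonormalBasis ℝ (EuclideanSpace ℝ (Fin 3)) with he
  set K : Set (EuclideanSpace ℝ (Fin 3)) := tsupport ψ with hK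
  have hv := fun x (hx : x ∉ K) => testFunction_vanish (ψ := ψ) hx
  have h1 : ∫ x, ⟪Bs x (ws x), ψ x • us x⟫ = ∫ x in K, ⟪us x, ψ x • Bs x (ws x)⟫ := by
    rw [← setIntegral_eq_integral_of_forall_compl_eq_zero (s := K)]
    · refine integral_congr_ae (Eventually.of_forall fun x => ?_)
      simp only
      rw [real_inner_smul_right, real_inner_smul_right, real_inner_comm]
    · intro x hx
      rw [(hv x hx).1, zero_smul, inner_zero_right]
  have h2 : ∫ x, qs x * fderiv ℝ ψ x (us x) = ∫ x in K, ⟪us x, qs x • gradient ψ x⟫ := by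
    rw [← setIntegral_eq_integral_of_forall_compl_eq_zero (s := K)]
    · refine integral_congr_ae (Eventually.of_forall fun x => ?_)
      simp only
      rw [real_inner_smul_right, real_inner_comm, inner_gradient_left]
    · intro x hx
      simp [(hv x hx).2.2]
  have h3 : ∫ x, ∑ i, ⟪Bs x (e i), fderiv ℝ ψ x (e i) • us x + ψ x • Gs x (e i)⟫ =
      (∫ x in K, ⟪us x, Bs x (gradient ψ x)⟫) + ∑ i, ∫ x in K, ⟪Gs x (ψ x • e i), Bs x (e i)⟫ := by
    rw [← integral_finsetSum _ (fun i _ => i4 i), ← integral_add i3 (integrable_finsetSum _ fun i _ => i4 i),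
      ← setIntegral_eq_integral_of_forall_compl_eq_zero (s := K)]
    · refine integral_congr_ae (Eventually.of_forall fun x => ?_)
      simp only
      rw [sum_inner_apply_basis_eq']
    · intro x hx
      refine Finset.sum_eq_zero fun i _ => ?_
      simp [(hv x hx).1, (hv x hx).2.2]
  rw [h1, h2, h3]

end SliceIdentities

/-! ## Integrability of the densities -/

section Densities

variable {T ν : ℝ} {u₀ : EuclideanSpace ℝ (Fin 3) → EuclideanSpace ℝ (Fin 3)}
  {u₁ u₂ u₃ u₄ : ℝ → EuclideanSpace ℝ (Fin 3) → EuclideanSpace ℝ (Fin 3)}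
  {p₁ p₂ : ℝ → EuclideanSpace ℝ (Fin 3) → ℝ}
  {G₁ G₂ : ℝ → EuclideanSpace ℝ (Fin 3) → EuclideanSpace ℝ (Fin 3) →L[ℝ] EuclideanSpace ℝ (Fin 3)}
  {m : ℝ → ℝ} {ε : ℝ} {ψ : EuclideanSpace ℝ (Fin 3) → ℝ}

set_option maxHeartbeats 1600000 in
/-- **Integrability of the two densities of the `u₁ · u₂` balance**, jointly on `(0,T)²` and on
the diagonal: for two local Leray solutions with weak gradients `G₁, G₂`, the first one regular
(`u₁ = u₃ + u₄`, `‖u₃(t)‖_∞ ≤ m(t)`, `m ∈ L²`, `‖u₄(t)‖_{L³} ≤ ε`), and a test function `ψ`, the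
density `f(σ,s)` of `u₁`'s equation at time `s` tested with `ψ u₂(σ)` and the density `g(s,σ)`
of `u₂`'s equation at time `σ` tested with `ψ u₁(s)` are integrable on `(0,T)²`, and
`s ↦ f(s,s)`, `s ↦ g(s,s)` are integrable on `(0,T)` (every term is a pairing of factors in dual
mixed Lebesgue spaces, `LocalLerayCrossBulkPairings`). [cite: LemarieRieusset2016, Thm. 14.7 proof p. 515] -/
theorem integrable_cross_densities
    (h₁ : IsLocalLeraySolutionOn T ν u₀ u₁ p₁) (h₂ : IsLocalLeraySolutionOn T ν u₀ u₂ p₂)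
    (hG₁ : HasWeakSpatialGradientOn (slab (EuclideanSpace ℝ (Fin 3)) (Ioo 0 T) isOpen_Ioo) u₁ G₁)
    (hG₂ : HasWeakSpatialGradientOn (slab (EuclideanSpace ℝ (Fin 3)) (Ioo 0 T) isOpen_Ioo) u₂ G₂)
    (hψ : IsTestFunctionOn (⊤ : Opens (EuclideanSpace ℝ (Fin 3))) ψ)
    (hu₃ : AEStronglyMeasurable (uncurry u₃)
      ((volume : Measure (ℝ × EuclideanSpace ℝ (Fin 3))).restrict (Ioo 0 T ×ˢ univ)))
    (hsplit : uncurry u₁ =ᵐ[(volume : Measure (ℝ × EuclideanSpace ℝ (Fin 3))).restrict (Ioo 0 T ×ˢ univ)]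
      fun z => u₃ z.1 z.2 + u₄ z.1 z.2)
    (hm : ∀ᵐ t ∂((volume : Measure ℝ).restrict (Ioo 0 T)), eLpNorm (u₃ t) ∞ volume ≤ ENNReal.ofReal (m t))
    (hm2 : IntegrableOn (fun t => m t ^ 2) (Ioo 0 T) volume)
    (hε : ∀ᵐ t ∂((volume : Measure ℝ).restrict (Ioo 0 T)), eLpNorm (u₄ t) 3 volume ≤ ENNReal.ofReal ε) :
    Integrable (fun p : ℝ × ℝ =>
        ((-∫ x, ⟪G₁ p.2 x (u₁ p.2 x), ψ x • u₂ p.1 x⟫) + ∫ x, p₁ p.2 x * fderiv ℝ ψ x (u₂ p.1 x)) -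
          ν * ∫ x, ∑ i, ⟪G₁ p.2 x (stdOrthonormalBasis ℝ (EuclideanSpace ℝ (Fin 3)) i),
            fderiv ℝ ψ x (stdOrthonormalBasis ℝ (EuclideanSpace ℝ (Fin 3)) i) • u₂ p.1 x + ψ x • G₂ p.1 x (stdOrthonormalBasis ℝ (EuclideanSpace ℝ (Fin 3)) i)⟫)
      (((volume : Measure ℝ).restrict (Ioo 0 T)).prod ((volume : Measure ℝ).restrict (Ioo 0 T))) ∧
    Integrable (fun p : ℝ × ℝ =>
        ((-∫ x, ⟪G₂ p.1 x (u₂ p.1 x), ψ x • u₁ p.2 x⟫) + ∫ x, p₂ p.1 x * fderiv ℝ ψ x (u₁ p.2 x)) -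
          ν * ∫ x, ∑ i, ⟪G₂ p.1 x (stdOrthonormalBasis ℝ (EuclideanSpace ℝ (Fin 3)) i),
            fderiv ℝ ψ x (stdOrthonormalBasis ℝ (EuclideanSpace ℝ (Fin 3)) i) • u₁ p.2 x + ψ x • G₁ p.2 x (stdOrthonormalBasis ℝ (EuclideanSpace ℝ (Fin 3)) i)⟫)
      (((volume : Measure ℝ).restrict (Ioo 0 T)).prod ((volume : Measure ℝ).restrict (Ioo 0 T))) ∧
    Integrable (fun s : ℝ =>
        ((-∫ x, ⟪G₁ s x (u₁ s x), ψ x • u₂ s x⟫) + ∫ x, p₁ s x * fderiv ℝ ψ x (u₂ s x)) -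
          ν * ∫ x, ∑ i, ⟪G₁ s x (stdOrthonormalBasis ℝ (EuclideanSpace ℝ (Fin 3)) i),
            fderiv ℝ ψ x (stdOrthonormalBasis ℝ (EuclideanSpace ℝ (Fin 3)) i) • u₂ s x + ψ x • G₂ s x (stdOrthonormalBasis ℝ (EuclideanSpace ℝ (Fin 3)) i)⟫)
      ((volume : Measure ℝ).restrict (Ioo 0 T)) ∧
    Integrable (fun s : ℝ =>
        ((-∫ x, ⟪G₂ s x (u₂ s x), ψ x • u₁ s x⟫) + ∫ x, p₂ s x * fderiv ℝ ψ x (u₁ s x)) -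
          ν * ∫ x, ∑ i, ⟪G₂ s x (stdOrthonormalBasis ℝ (EuclideanSpace ℝ (Fin 3)) i),
            fderiv ℝ ψ x (stdOrthonormalBasis ℝ (EuclideanSpace ℝ (Fin 3)) i) • u₁ s x + ψ x • G₁ s x (stdOrthonormalBasis ℝ (EuclideanSpace ℝ (Fin 3)) i)⟫)
      ((volume : Measure ℝ).restrict (Ioo 0 T)) := by
  -- ### the test function, the cylinder, the exponents
  obtain ⟨hK, hψc, hgc, ⟨Cψ, hCψ0, hψb, hgb⟩, hψ0, hg0⟩ := testFunction_facts hψ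
  set K : Set (EuclideanSpace ℝ (Fin 3)) := tsupport ψ with hKdef
  set μI : Measure ℝ := volume.restrict (Ioo 0 T) with hμI
  set μK : Measure (EuclideanSpace ℝ (Fin 3)) := volume.restrict K with hμK
  set e := stdOrthonormalBasis ℝ (EuclideanSpace ℝ (Fin 3)) with he
  haveI : IsFiniteMeasure μI := by rw [hμI]; infer_instance
  haveI i65 := holderConjugate_sixFifths_six
  haveI i32 := holderConjugate_threeHalves_three
  haveI i3 : ENNReal.HolderConjugate 3 (ENNReal.ofReal (3 / 2)) := inferInstance
  haveI i1 : ENNReal.HolderConjugate (∞ : ℝ≥0∞) 1 := inferInstance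
  have h32r : (3 / 2 : ℝ).HolderConjugate 3 := Real.holderConjugate_iff.2 ⟨by norm_num, by norm_num⟩
  have h3r : (3 : ℝ).HolderConjugate (3 / 2) := h32r.symm
  have hne65 : ENNReal.ofReal (6 / 5) ≠ ∞ := ENNReal.ofReal_ne_top
  have hne32 : ENNReal.ofReal (3 / 2) ≠ ∞ := ENNReal.ofReal_ne_top
  -- ### the fields on the cylinder
  have hu₁m : AEStronglyMeasurable (uncurry u₁) (μI.prod μK) := h₁.aestronglyMeasurable_prod_restrict K
  have hu₂m : AEStronglyMeasurable (uncurry u₂) (μI.prod μK) := h₂.aestronglyMeasurable_prod_restrict K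
  have hu₃K : AEStronglyMeasurable (uncurry u₃) (μI.prod μK) := by
    rw [hμI, hμK, prod_restrict_eq_restrict_cylinder]
    exact hu₃.mono_measure (Measure.restrict_mono (prod_mono Subset.rfl (subset_univ _)) le_rfl)
  have hdm : AEStronglyMeasurable (uncurry fun s x => u₁ s x - u₃ s x) (μI.prod μK) := hu₁m.sub hu₃K
  have hmK := ae_eLpNorm_slice_top_restrict_le hm K
  have hε3 := ae_eLpNorm_sub_slice_three_le hsplit hε K
  obtain ⟨hmm, hmm2⟩ := aemeasurable_enorm_and_lintegral_sq_lt_top_of_integrableOn_sq hm2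
  -- slice norms of `u₁`, `u₂`
  obtain ⟨Cb2, hCb2, hbB2⟩ := h₂.exists_ae_eLpNorm_slice_two_le hK
  have h22 := (h₂.lintegral_eLpNorm_slice_two_lt_top hK).ne
  have h33 := (h₂.lintegral_eLpNorm_slice_three_lt_top hK).ne
  have h66 := (h₂.lintegral_eLpNorm_slice_six_sq_lt_top hG₂ hK).ne
  have h1_33 := (h₁.lintegral_eLpNorm_slice_three_lt_top hK).ne
  have h1_22 := (h₁.lintegral_eLpNorm_slice_two_lt_top hK).ne
  -- the unweighted first factors
  obtain ⟨ha1, haN1⟩ := pairing_one_a' hK h₁ hG₁ hu₃K hmK hm2 hψc hψb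
  obtain ⟨ha2, haN2⟩ := pairing_two_a' hK h₁ hG₁ hu₃K hε3 hψc hψb
  obtain ⟨ha3, -, haN3⟩ := pairing_pressure_factor' hK h₁ hgc hgb
  obtain ⟨ha4, -, haN4⟩ := pairing_gradient_factor' hK h₁ hG₁ hgc hgb
  have ha5 : ∀ i, AEStronglyMeasurable (uncurry fun s x => G₁ s x (ψ x • e i)) (μI.prod μK) ∧
      Integrable (uncurry fun s x => G₁ s x (ψ x • e i)) (μI.prod μK) ∧
      ∫⁻ s, eLpNorm (fun x => G₁ s x (ψ x • e i)) 2 μK ^ (2 : ℝ) ∂μI ≠ ∞ := fun i =>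
    pairing_gradient_factor' hK h₁ hG₁ (c := fun x => ψ x • e i) (hψc.smul continuous_const) (Cc := Cψ)
      fun x => by rw [norm_smul, e.orthonormal.1 i, mul_one]; exact hψb x
  have hb5 : ∀ i, AEStronglyMeasurable (uncurry fun s x => G₂ s x (e i)) (μI.prod μK) ∧
      Integrable (uncurry fun s x => G₂ s x (e i)) (μI.prod μK) ∧
      ∫⁻ s, eLpNorm (fun x => G₂ s x (e i)) 2 μK ^ (2 : ℝ) ∂μI ≠ ∞ := fun i =>
    pairing_gradient_factor' hK h₂ hG₂ (c := fun _ => e i) continuous_const (Cc := 1)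
      fun x => by rw [e.orthonormal.1 i]
  obtain ⟨hb8, hb8i, hbN8⟩ := pairing_pressure_factor' hK h₂ hgc hgb
  obtain ⟨hb9, hb9i, hbN9⟩ := pairing_gradient_factor' (c := gradient ψ) hK h₂ hG₂ hgc hgb
  obtain ⟨ha6', haN6', haN7'⟩ := pairing_six_seven_a' hK h₂ hG₂
  -- `ψ ∇u₂ u₂`
  have hbGU : AEStronglyMeasurable (uncurry fun σ x => ψ x • G₂ σ x (u₂ σ x)) (μI.prod μK) :=
    (hψc.comp continuous_snd).aestronglyMeasurable.smul ha6'
  have hbGUle : ∀ (q : ℝ≥0∞) σ, eLpNorm (fun x => ψ x • G₂ σ x (u₂ σ x)) q μK ≤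
      ENNReal.ofReal Cψ * eLpNorm (fun x => G₂ σ x (u₂ σ x)) q μK := fun q σ =>
    eLpNorm_smul_le_of_norm_le hψb _ q
  have hbGUN1 : ∫⁻ σ, eLpNorm (fun x => ψ x • G₂ σ x (u₂ σ x)) 1 μK ^ (2 : ℝ) ∂μI ≠ ∞ :=
    lintegral_rpow_ne_top_of_le_const_mul ENNReal.ofReal_ne_top (hbGUle 1) (by norm_num) haN6'
  have hbGUN32 : ∫⁻ σ, eLpNorm (fun x => ψ x • G₂ σ x (u₂ σ x)) (ENNReal.ofReal (3 / 2)) μK ∂μI ≠ ∞ := by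
    refine ne_top_of_le_ne_top ?_ (lintegral_mono (hbGUle _))
    rw [lintegral_const_mul' _ _ ENNReal.ofReal_ne_top]
    exact ENNReal.mul_ne_top ENNReal.ofReal_ne_top haN7'
  have hu3N : ∫⁻ s, eLpNorm (u₃ s) ∞ μK ^ (2 : ℝ) ∂μI ≠ ∞ :=
    lintegral_rpow_ne_top_of_ae_le_const_mul (C := 1) ENNReal.one_ne_top
      (hmK.mono fun s hs => by rwa [one_mul]) (by norm_num) hmm2.ne
  -- `L¹` in time of the slice norms
  have l_u2_2 := lintegral_eLpNorm_slice_ne_top_of_rpow hu₂m 2 one_le_two h22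
  have l_u2_6 := lintegral_eLpNorm_slice_ne_top_of_rpow hu₂m 6 one_le_two h66
  have l_u2_3 := lintegral_eLpNorm_slice_ne_top_of_rpow hu₂m 3 (by norm_num : (1:ℝ) ≤ 3) h33
  have l_u1_3 := lintegral_eLpNorm_slice_ne_top_of_rpow hu₁m 3 (by norm_num : (1:ℝ) ≤ 3) h1_33
  have l_u1_2 := lintegral_eLpNorm_slice_ne_top_of_rpow hu₁m 2 one_le_two h1_22
  have l_a2 := lintegral_eLpNorm_slice_ne_top_of_rpow ha2 _ one_le_two haN2
  have l_a3 := lintegral_eLpNorm_slice_ne_top_of_rpow ha3 _ (by norm_num : (1:ℝ) ≤ 3 / 2) haN3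
  have l_a4 := lintegral_eLpNorm_slice_ne_top_of_rpow ha4 _ one_le_two haN4
  have l_a5 := fun i => lintegral_eLpNorm_slice_ne_top_of_rpow (ha5 i).1 _ one_le_two (ha5 i).2.2
  have l_b5 := fun i => lintegral_eLpNorm_slice_ne_top_of_rpow (hb5 i).1 _ one_le_two (hb5 i).2.2
  have l_b8 := lintegral_eLpNorm_slice_ne_top_of_rpow hb8 _ (by norm_num : (1:ℝ) ≤ 3 / 2) hbN8
  have l_b9 := lintegral_eLpNorm_slice_ne_top_of_rpow hb9 _ one_le_two hbN9
  -- a.e. finiteness of the slice norms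
  have f_a1 : ∀ᵐ s ∂μI, eLpNorm (fun x => ψ x • G₁ s x (u₃ s x)) 2 μK < ∞ :=
    ae_lt_top' (aemeasurable_eLpNorm_slice ha1 2) haN1
  have f_a2 := ae_eLpNorm_slice_lt_top_of_rpow ha2 _ two_pos haN2
  have f_a3 := ae_eLpNorm_slice_lt_top_of_rpow ha3 _ (by norm_num : (0:ℝ) < 3 / 2) haN3
  have f_a4 := ae_eLpNorm_slice_lt_top_of_rpow ha4 _ two_pos haN4
  have f_a5 := fun i => ae_eLpNorm_slice_lt_top_of_rpow (ha5 i).1 _ two_pos (ha5 i).2.2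
  have f_b5 := fun i => ae_eLpNorm_slice_lt_top_of_rpow (hb5 i).1 _ two_pos (hb5 i).2.2
  have f_u2_2 : ∀ᵐ σ ∂μI, eLpNorm (u₂ σ) 2 μK < ∞ := hbB2.mono fun σ h => h.trans_lt hCb2.lt_top
  have f_u2_6 := ae_eLpNorm_slice_lt_top_of_rpow hu₂m 6 two_pos h66
  have f_u2_3 := ae_eLpNorm_slice_lt_top_of_rpow hu₂m 3 (by norm_num : (0:ℝ) < 3) h33
  have f_u1_3 := ae_eLpNorm_slice_lt_top_of_rpow hu₁m 3 (by norm_num : (0:ℝ) < 3) h1_33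
  have f_u1_2 := ae_eLpNorm_slice_lt_top_of_rpow hu₁m 2 two_pos h1_22
  have f_b8 := ae_eLpNorm_slice_lt_top_of_rpow hb8 _ (by norm_num : (0:ℝ) < 3 / 2) hbN8
  have f_b9 := ae_eLpNorm_slice_lt_top_of_rpow hb9 _ two_pos hbN9
  have f_bGU32 : ∀ᵐ σ ∂μI, eLpNorm (fun x => ψ x • G₂ σ x (u₂ σ x)) (ENNReal.ofReal (3 / 2)) μK < ∞ :=
    ae_lt_top' (aemeasurable_eLpNorm_slice hbGU _) hbGUN32
  have f_bGU1 := ae_eLpNorm_slice_lt_top_of_rpow hbGU 1 two_pos hbGUN1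
  have f_u3 := ae_eLpNorm_slice_lt_top_of_rpow hu₃K ∞ two_pos hu3N
  have f_d3 : ∀ᵐ s ∂μI, eLpNorm (fun x => u₁ s x - u₃ s x) 3 μK < ∞ :=
    hε3.mono fun s h => h.trans_lt ENNReal.ofReal_lt_top
  -- ### joint `x`-integrability
  have xi1 := ae_integrable_inner_slices (μ := volume) ha1 hu₂m 2 2 f_a1 f_u2_2
  have xi2 := ae_integrable_inner_slices (μ := volume) ha2 hu₂m (ENNReal.ofReal (6 / 5)) 6 f_a2 f_u2_6
  have xi4 := ae_integrable_inner_slices (μ := volume) ha4 hu₂m 2 2 f_a4 f_u2_2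
  have xi5 := fun i => ae_integrable_inner_slices (μ := volume) (ha5 i).1 (hb5 i).1 2 2 (f_a5 i) (f_b5 i)
  have xig3 := ae_integrable_inner_slices (μ := volume) hu₁m hb9 2 2 f_u1_2 f_b9
  -- ### the joint identities
  have hfeq : ∀ᵐ p ∂(μI.prod μI),
      (((-∫ x, ⟪G₁ p.2 x (u₁ p.2 x), ψ x • u₂ p.1 x⟫) + ∫ x, p₁ p.2 x * fderiv ℝ ψ x (u₂ p.1 x)) -
          ν * ∫ x, ∑ i, ⟪G₁ p.2 x (stdOrthonormalBasis ℝ (EuclideanSpace ℝ (Fin 3)) i),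
            fderiv ℝ ψ x (stdOrthonormalBasis ℝ (EuclideanSpace ℝ (Fin 3)) i) • u₂ p.1 x + ψ x • G₂ p.1 x (stdOrthonormalBasis ℝ (EuclideanSpace ℝ (Fin 3)) i)⟫) =
      ((-((∫ x in K, ⟪ψ x • G₁ p.2 x (u₃ p.2 x), u₂ p.1 x⟫) + ∫ x in K, ⟪ψ x • G₁ p.2 x (u₁ p.2 x - u₃ p.2 x), u₂ p.1 x⟫)) +
          ∫ x in K, ⟪p₁ p.2 x • gradient ψ x, u₂ p.1 x⟫) -
        ν * ((∫ x in K, ⟪G₁ p.2 x (gradient ψ x), u₂ p.1 x⟫) + ∑ i, ∫ x in K, ⟪G₁ p.2 x (ψ x • e i), G₂ p.1 x (e i)⟫) := by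
    filter_upwards [xi1, xi2, xi4, ae_all_iff.2 xi5] with p i1 i2 i3 i4
    exact cross_density_f_eq ν i1 i2 i3 i4
  have hgeq : ∀ᵐ p ∂(μI.prod μI),
      (((-∫ x, ⟪G₂ p.1 x (u₂ p.1 x), ψ x • u₁ p.2 x⟫) + ∫ x, p₂ p.1 x * fderiv ℝ ψ x (u₁ p.2 x)) -
          ν * ∫ x, ∑ i, ⟪G₂ p.1 x (stdOrthonormalBasis ℝ (EuclideanSpace ℝ (Fin 3)) i),
            fderiv ℝ ψ x (stdOrthonormalBasis ℝ (EuclideanSpace ℝ (Fin 3)) i) • u₁ p.2 x + ψ x • G₁ p.2 x (stdOrthonormalBasis ℝ (EuclideanSpace ℝ (Fin 3)) i)⟫) =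
      ((-(∫ x in K, ⟪u₁ p.2 x, ψ x • G₂ p.1 x (u₂ p.1 x)⟫)) + ∫ x in K, ⟪u₁ p.2 x, p₂ p.1 x • gradient ψ x⟫) -
        ν * ((∫ x in K, ⟪u₁ p.2 x, G₂ p.1 x (gradient ψ x)⟫) + ∑ i, ∫ x in K, ⟪G₁ p.2 x (ψ x • e i), G₂ p.1 x (e i)⟫) := by
    filter_upwards [xig3, ae_all_iff.2 xi5] with p i3 i4
    exact cross_density_g_eq ν i3 i4
  -- ### joint integrability of the pieces
  have I1 := integrable_integral_inner_prod (μ := volume) ha1 hu₂m 2 2 haN1 l_u2_2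
  have I2 := integrable_integral_inner_prod (μ := volume) ha2 hu₂m (ENNReal.ofReal (6 / 5)) 6 l_a2 l_u2_6
  have I3 := integrable_integral_inner_prod (μ := volume) ha3 hu₂m (ENNReal.ofReal (3 / 2)) 3 l_a3 l_u2_3
  have I4 := integrable_integral_inner_prod (μ := volume) ha4 hu₂m 2 2 l_a4 l_u2_2
  have I5 := fun i => integrable_integral_inner_prod (μ := volume) (ha5 i).1 (hb5 i).1 2 2 (l_a5 i) (l_b5 i)
  have Ig1 := integrable_integral_inner_prod (μ := volume) hu₁m hbGU 3 (ENNReal.ofReal (3 / 2)) l_u1_3 hbGUN32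
  have Ig2 := integrable_integral_inner_prod (μ := volume) hu₁m hb8 3 (ENNReal.ofReal (3 / 2)) l_u1_3 l_b8
  have Ig3 := integrable_integral_inner_prod (μ := volume) hu₁m hb9 2 2 l_u1_2 l_b9
  have hF : Integrable (fun p : ℝ × ℝ =>
      ((-((∫ x in K, ⟪ψ x • G₁ p.2 x (u₃ p.2 x), u₂ p.1 x⟫) + ∫ x in K, ⟪ψ x • G₁ p.2 x (u₁ p.2 x - u₃ p.2 x), u₂ p.1 x⟫)) +
          ∫ x in K, ⟪p₁ p.2 x • gradient ψ x, u₂ p.1 x⟫) -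
        ν * ((∫ x in K, ⟪G₁ p.2 x (gradient ψ x), u₂ p.1 x⟫) + ∑ i, ∫ x in K, ⟪G₁ p.2 x (ψ x • e i), G₂ p.1 x (e i)⟫))
      (μI.prod μI) :=
    ((I1.add I2).neg.add I3).sub ((I4.add (integrable_finsetSum _ fun i _ => I5 i)).const_mul ν)
  have hG : Integrable (fun p : ℝ × ℝ =>
      ((-(∫ x in K, ⟪u₁ p.2 x, ψ x • G₂ p.1 x (u₂ p.1 x)⟫)) + ∫ x in K, ⟪u₁ p.2 x, p₂ p.1 x • gradient ψ x⟫) -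
        ν * ((∫ x in K, ⟪u₁ p.2 x, G₂ p.1 x (gradient ψ x)⟫) + ∑ i, ∫ x in K, ⟪G₁ p.2 x (ψ x • e i), G₂ p.1 x (e i)⟫))
      (μI.prod μI) :=
    (Ig1.neg.add Ig2).sub ((Ig3.add (integrable_finsetSum _ fun i _ => I5 i)).const_mul ν)
  -- ### diagonal `x`-integrability and identities
  have dx1 := ae_integrable_inner_diag (μ := volume) ha1 hu₂m 2 2 f_a1 f_u2_2
  have dx2 := ae_integrable_inner_diag (μ := volume) ha2 hu₂m (ENNReal.ofReal (6 / 5)) 6 f_a2 f_u2_6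
  have dx4 := ae_integrable_inner_diag (μ := volume) ha4 hu₂m 2 2 f_a4 f_u2_2
  have dx5 := fun i => ae_integrable_inner_diag (μ := volume) (ha5 i).1 (hb5 i).1 2 2 (f_a5 i) (f_b5 i)
  have dxg3 := ae_integrable_inner_diag (μ := volume) hu₁m hb9 2 2 f_u1_2 f_b9
  have dxu3 := ae_integrable_inner_diag (μ := volume) hu₃K hbGU ∞ 1 f_u3 f_bGU1
  have dxd := ae_integrable_inner_diag (μ := volume) hdm hbGU 3 (ENNReal.ofReal (3 / 2)) f_d3 f_bGU32
  have hfeq_d : ∀ᵐ s ∂μI,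
      (((-∫ x, ⟪G₁ s x (u₁ s x), ψ x • u₂ s x⟫) + ∫ x, p₁ s x * fderiv ℝ ψ x (u₂ s x)) -
          ν * ∫ x, ∑ i, ⟪G₁ s x (stdOrthonormalBasis ℝ (EuclideanSpace ℝ (Fin 3)) i),
            fderiv ℝ ψ x (stdOrthonormalBasis ℝ (EuclideanSpace ℝ (Fin 3)) i) • u₂ s x + ψ x • G₂ s x (stdOrthonormalBasis ℝ (EuclideanSpace ℝ (Fin 3)) i)⟫) =
      ((-((∫ x in K, ⟪ψ x • G₁ s x (u₃ s x), u₂ s x⟫) + ∫ x in K, ⟪ψ x • G₁ s x (u₁ s x - u₃ s x), u₂ s x⟫)) +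
          ∫ x in K, ⟪p₁ s x • gradient ψ x, u₂ s x⟫) -
        ν * ((∫ x in K, ⟪G₁ s x (gradient ψ x), u₂ s x⟫) + ∑ i, ∫ x in K, ⟪G₁ s x (ψ x • e i), G₂ s x (e i)⟫) := by
    filter_upwards [dx1, dx2, dx4, ae_all_iff.2 dx5] with s i1 i2 i3 i4
    exact cross_density_f_eq ν i1 i2 i3 i4
  have hgeq_d : ∀ᵐ s ∂μI,
      (((-∫ x, ⟪G₂ s x (u₂ s x), ψ x • u₁ s x⟫) + ∫ x, p₂ s x * fderiv ℝ ψ x (u₁ s x)) -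
          ν * ∫ x, ∑ i, ⟪G₂ s x (stdOrthonormalBasis ℝ (EuclideanSpace ℝ (Fin 3)) i),
            fderiv ℝ ψ x (stdOrthonormalBasis ℝ (EuclideanSpace ℝ (Fin 3)) i) • u₁ s x + ψ x • G₁ s x (stdOrthonormalBasis ℝ (EuclideanSpace ℝ (Fin 3)) i)⟫) =
      ((-(∫ x in K, ⟪u₁ s x, ψ x • G₂ s x (u₂ s x)⟫)) + ∫ x in K, ⟪u₁ s x, p₂ s x • gradient ψ x⟫) -
        ν * ((∫ x in K, ⟪u₁ s x, G₂ s x (gradient ψ x)⟫) + ∑ i, ∫ x in K, ⟪G₁ s x (ψ x • e i), G₂ s x (e i)⟫) := by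
    filter_upwards [dxg3, ae_all_iff.2 dx5] with s i3 i4
    exact cross_density_g_eq ν i3 i4
  -- ### diagonal integrability of the pieces
  have J1 := (integrable_inner_diag_of_ae_le (μ := volume) ha1 hu₂m 2 2 haN1 hCb2 hbB2).integral_prod_left
  have J2 := (integrable_inner_diag_of_rpow (μ := volume) ha2 hu₂m Real.HolderConjugate.two_two
    (ENNReal.ofReal (6 / 5)) 6 haN2 h66).integral_prod_left
  have J3 := (integrable_inner_diag_of_rpow (μ := volume) ha3 hu₂m h32r (ENNReal.ofReal (3 / 2)) 3 haN3 h33).integral_prod_left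
  have J4 := (integrable_inner_diag_of_rpow (μ := volume) ha4 hu₂m Real.HolderConjugate.two_two 2 2 haN4 h22).integral_prod_left
  have J5 := fun i => (integrable_inner_diag_of_rpow (μ := volume) (ha5 i).1 (hb5 i).1
    Real.HolderConjugate.two_two 2 2 (ha5 i).2.2 (hb5 i).2.2).integral_prod_left
  have Jg2 := (integrable_inner_diag_of_rpow (μ := volume) hu₁m hb8 h3r 3 (ENNReal.ofReal (3 / 2)) h1_33 hbN8).integral_prod_left
  have Jg3 := (integrable_inner_diag_of_rpow (μ := volume) hu₁m hb9 Real.HolderConjugate.two_two 2 2 h1_22 hbN9).integral_prod_left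
  have Ju3 := (integrable_inner_diag_of_rpow (μ := volume) hu₃K hbGU Real.HolderConjugate.two_two ∞ 1 hu3N hbGUN1).integral_prod_left
  have Jd := (integrable_inner_diag_of_ae_le (μ := volume) hbGU hdm (ENNReal.ofReal (3 / 2)) 3 hbGUN32
    ENNReal.ofReal_ne_top hε3).integral_prod_left
  -- the first diagonal `g`-term, through the splitting `u₁ = u₃ + (u₁ - u₃)`
  have Jg1 : Integrable (fun s => ∫ x in K, ⟪u₁ s x, ψ x • G₂ s x (u₂ s x)⟫) μI := by
    have hsum : Integrable (fun s => (∫ x in K, ⟪u₃ s x, ψ x • G₂ s x (u₂ s x)⟫) +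
        ∫ x in K, ⟪ψ x • G₂ s x (u₂ s x), u₁ s x - u₃ s x⟫) μI := Ju3.add Jd
    refine hsum.congr ?_
    filter_upwards [dxu3, dxd] with s i1 i2
    have i2' : Integrable (fun x => ⟪ψ x • G₂ s x (u₂ s x), u₁ s x - u₃ s x⟫) μK :=
      i2.congr (Eventually.of_forall fun x => real_inner_comm _ _)
    rw [← integral_add i1 i2']
    refine integral_congr_ae (Eventually.of_forall fun x => ?_)
    simp only
    rw [real_inner_comm (ψ x • G₂ s x (u₂ s x)), ← inner_add_right, add_sub_cancel, real_inner_comm]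
  have hFd : Integrable (fun s : ℝ =>
      ((-((∫ x in K, ⟪ψ x • G₁ s x (u₃ s x), u₂ s x⟫) + ∫ x in K, ⟪ψ x • G₁ s x (u₁ s x - u₃ s x), u₂ s x⟫)) +
          ∫ x in K, ⟪p₁ s x • gradient ψ x, u₂ s x⟫) -
        ν * ((∫ x in K, ⟪G₁ s x (gradient ψ x), u₂ s x⟫) + ∑ i, ∫ x in K, ⟪G₁ s x (ψ x • e i), G₂ s x (e i)⟫)) μI :=
    ((J1.add J2).neg.add J3).sub ((J4.add (integrable_finsetSum _ fun i _ => J5 i)).const_mul ν)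
  have hGd : Integrable (fun s : ℝ =>
      ((-(∫ x in K, ⟪u₁ s x, ψ x • G₂ s x (u₂ s x)⟫)) + ∫ x in K, ⟪u₁ s x, p₂ s x • gradient ψ x⟫) -
        ν * ((∫ x in K, ⟪u₁ s x, G₂ s x (gradient ψ x)⟫) + ∑ i, ∫ x in K, ⟪G₁ s x (ψ x • e i), G₂ s x (e i)⟫)) μI :=
    (Jg1.neg.add Jg2).sub ((Jg3.add (integrable_finsetSum _ fun i _ => J5 i)).const_mul ν)
  exact ⟨hF.congr (hfeq.mono fun p hp => hp.symm), hG.congr (hgeq.mono fun p hp => hp.symm),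
    hFd.congr (hfeq_d.mono fun s hs => hs.symm), hGd.congr (hgeq_d.mono fun s hs => hs.symm)⟩

/-- `c ∫ ⟪A, B⟫ = ∫ ⟪c A, B⟫`. [folklore] -/
theorem const_mul_integral_inner {κ : Measure (EuclideanSpace ℝ (Fin 3))} (c : ℝ)
    (A B : EuclideanSpace ℝ (Fin 3) → EuclideanSpace ℝ (Fin 3)) :
    c * ∫ x, ⟪A x, B x⟫ ∂κ = ∫ x, ⟪c • A x, B x⟫ ∂κ := by
  rw [← integral_const_mul]
  exact integral_congr_ae (Eventually.of_forall fun x => (real_inner_smul_left _ _ _).symm)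

set_option maxHeartbeats 4000000 in
/-- **The limit in the time doubling of the `u₁ · u₂` balance.** In the setting of
`integrable_cross_densities`, for every continuous cut-off `χ` supported in `[δ, T-δ]` (`δ > 0`)
and every sequence of even bump kernels `ρₙ` with `rOut ρₙ → 0`,
`∫∫ ρₙ(s-σ) χ(s) (f(σ,s) + g(s,σ)) dσ ds → ∫ χ(s) (f(s,s) + g(s,s)) ds`
(the nine atomic pairings of `LocalLerayCrossBulkPairings` and the mixed-norm doubled-pairing
packages; Lemarié-Rieusset 2016, Thm. 14.7, proof p. 515, limit in the mollification of the
balance for `u₁ · u₂`). [cite: LemarieRieusset2016, Thm. 14.7 proof p. 515] -/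
theorem tendsto_cross_bulk
    (h₁ : IsLocalLeraySolutionOn T ν u₀ u₁ p₁) (h₂ : IsLocalLeraySolutionOn T ν u₀ u₂ p₂)
    (hG₁ : HasWeakSpatialGradientOn (slab (EuclideanSpace ℝ (Fin 3)) (Ioo 0 T) isOpen_Ioo) u₁ G₁)
    (hG₂ : HasWeakSpatialGradientOn (slab (EuclideanSpace ℝ (Fin 3)) (Ioo 0 T) isOpen_Ioo) u₂ G₂)
    (hψ : IsTestFunctionOn (⊤ : Opens (EuclideanSpace ℝ (Fin 3))) ψ)
    (hu₃ : AEStronglyMeasurable (uncurry u₃)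
      ((volume : Measure (ℝ × EuclideanSpace ℝ (Fin 3))).restrict (Ioo 0 T ×ˢ univ)))
    (hsplit : uncurry u₁ =ᵐ[(volume : Measure (ℝ × EuclideanSpace ℝ (Fin 3))).restrict (Ioo 0 T ×ˢ univ)]
      fun z => u₃ z.1 z.2 + u₄ z.1 z.2)
    (hm : ∀ᵐ t ∂((volume : Measure ℝ).restrict (Ioo 0 T)), eLpNorm (u₃ t) ∞ volume ≤ ENNReal.ofReal (m t))
    (hm2 : IntegrableOn (fun t => m t ^ 2) (Ioo 0 T) volume)
    (hε : ∀ᵐ t ∂((volume : Measure ℝ).restrict (Ioo 0 T)), eLpNorm (u₄ t) 3 volume ≤ ENNReal.ofReal ε)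
    {χ : ℝ → ℝ} (hχc : Continuous χ) {Cχ : ℝ} (hχb : ∀ s, ‖χ s‖ ≤ Cχ) {δ : ℝ} (hδ : 0 < δ)
    (hχ0 : ∀ s, s ∉ Icc δ (T - δ) → χ s = 0)
    {φ : ℕ → ContDiffBump (0 : ℝ)} (hφ : Tendsto (fun n => (φ n).rOut) atTop (𝓝 0)) :
    Tendsto (fun n => ∫ p, (φ n).normed volume (p.2 - p.1) * χ p.2 *
        ((((-∫ x, ⟪G₁ p.2 x (u₁ p.2 x), ψ x • u₂ p.1 x⟫) + ∫ x, p₁ p.2 x * fderiv ℝ ψ x (u₂ p.1 x)) -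
          ν * ∫ x, ∑ i, ⟪G₁ p.2 x (stdOrthonormalBasis ℝ (EuclideanSpace ℝ (Fin 3)) i),
            fderiv ℝ ψ x (stdOrthonormalBasis ℝ (EuclideanSpace ℝ (Fin 3)) i) • u₂ p.1 x + ψ x • G₂ p.1 x (stdOrthonormalBasis ℝ (EuclideanSpace ℝ (Fin 3)) i)⟫) +
         (((-∫ x, ⟪G₂ p.1 x (u₂ p.1 x), ψ x • u₁ p.2 x⟫) + ∫ x, p₂ p.1 x * fderiv ℝ ψ x (u₁ p.2 x)) -
          ν * ∫ x, ∑ i, ⟪G₂ p.1 x (stdOrthonormalBasis ℝ (EuclideanSpace ℝ (Fin 3)) i),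
            fderiv ℝ ψ x (stdOrthonormalBasis ℝ (EuclideanSpace ℝ (Fin 3)) i) • u₁ p.2 x + ψ x • G₁ p.2 x (stdOrthonormalBasis ℝ (EuclideanSpace ℝ (Fin 3)) i)⟫))
        ∂(((volume : Measure ℝ).restrict (Ioo 0 T)).prod ((volume : Measure ℝ).restrict (Ioo 0 T)))) atTop
      (𝓝 (∫ s in Ioo 0 T, χ s *
        ((((-∫ x, ⟪G₁ s x (u₁ s x), ψ x • u₂ s x⟫) + ∫ x, p₁ s x * fderiv ℝ ψ x (u₂ s x)) -
          ν * ∫ x, ∑ i, ⟪G₁ s x (stdOrthonormalBasis ℝ (EuclideanSpace ℝ (Fin 3)) i),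
            fderiv ℝ ψ x (stdOrthonormalBasis ℝ (EuclideanSpace ℝ (Fin 3)) i) • u₂ s x + ψ x • G₂ s x (stdOrthonormalBasis ℝ (EuclideanSpace ℝ (Fin 3)) i)⟫) +
         (((-∫ x, ⟪G₂ s x (u₂ s x), ψ x • u₁ s x⟫) + ∫ x, p₂ s x * fderiv ℝ ψ x (u₁ s x)) -
          ν * ∫ x, ∑ i, ⟪G₂ s x (stdOrthonormalBasis ℝ (EuclideanSpace ℝ (Fin 3)) i),
            fderiv ℝ ψ x (stdOrthonormalBasis ℝ (EuclideanSpace ℝ (Fin 3)) i) • u₁ s x + ψ x • G₁ s x (stdOrthonormalBasis ℝ (EuclideanSpace ℝ (Fin 3)) i)⟫)))) := by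
  -- ### the test function, the cylinder, the exponents
  obtain ⟨hK, hψc, hgc, ⟨Cψ, hCψ0, hψb, hgb⟩, hψ0, hg0⟩ := testFunction_facts hψ
  set K : Set (EuclideanSpace ℝ (Fin 3)) := tsupport ψ with hKdef
  set μI : Measure ℝ := volume.restrict (Ioo 0 T) with hμI
  set μK : Measure (EuclideanSpace ℝ (Fin 3)) := volume.restrict K with hμK
  set e := stdOrthonormalBasis ℝ (EuclideanSpace ℝ (Fin 3)) with he
  haveI : IsFiniteMeasure μI := by rw [hμI]; infer_instance
  haveI i65 := holderConjugate_sixFifths_six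
  haveI i32 := holderConjugate_threeHalves_three
  haveI i3 : ENNReal.HolderConjugate 3 (ENNReal.ofReal (3 / 2)) := inferInstance
  haveI i1 : ENNReal.HolderConjugate (∞ : ℝ≥0∞) 1 := inferInstance
  have h32r : (3 / 2 : ℝ).HolderConjugate 3 := Real.holderConjugate_iff.2 ⟨by norm_num, by norm_num⟩
  have h3r : (3 : ℝ).HolderConjugate (3 / 2) := h32r.symm
  have hne65 : ENNReal.ofReal (6 / 5) ≠ ∞ := ENNReal.ofReal_ne_top
  have hne32 : ENNReal.ofReal (3 / 2) ≠ ∞ := ENNReal.ofReal_ne_top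
  -- ### the fields on the cylinder
  have hu₁m : AEStronglyMeasurable (uncurry u₁) (μI.prod μK) := h₁.aestronglyMeasurable_prod_restrict K
  have hu₂m : AEStronglyMeasurable (uncurry u₂) (μI.prod μK) := h₂.aestronglyMeasurable_prod_restrict K
  have hu₃K : AEStronglyMeasurable (uncurry u₃) (μI.prod μK) := by
    rw [hμI, hμK, prod_restrict_eq_restrict_cylinder]
    exact hu₃.mono_measure (Measure.restrict_mono (prod_mono Subset.rfl (subset_univ _)) le_rfl)
  have hdm : AEStronglyMeasurable (uncurry fun s x => u₁ s x - u₃ s x) (μI.prod μK) := hu₁m.sub hu₃K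
  have hmK := ae_eLpNorm_slice_top_restrict_le hm K
  have hε3 := ae_eLpNorm_sub_slice_three_le hsplit hε K
  obtain ⟨hmm, hmm2⟩ := aemeasurable_enorm_and_lintegral_sq_lt_top_of_integrableOn_sq hm2
  -- slice norms of `u₁`, `u₂`
  obtain ⟨Cb2, hCb2, hbB2⟩ := h₂.exists_ae_eLpNorm_slice_two_le hK
  have h22 := (h₂.lintegral_eLpNorm_slice_two_lt_top hK).ne
  have h33 := (h₂.lintegral_eLpNorm_slice_three_lt_top hK).ne
  have h66 := (h₂.lintegral_eLpNorm_slice_six_sq_lt_top hG₂ hK).ne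
  have h1_33 := (h₁.lintegral_eLpNorm_slice_three_lt_top hK).ne
  have h1_22 := (h₁.lintegral_eLpNorm_slice_two_lt_top hK).ne
  -- the unweighted first factors
  obtain ⟨ha1, haN1⟩ := pairing_one_a' hK h₁ hG₁ hu₃K hmK hm2 hψc hψb
  obtain ⟨ha2, haN2⟩ := pairing_two_a' hK h₁ hG₁ hu₃K hε3 hψc hψb
  obtain ⟨ha3, -, haN3⟩ := pairing_pressure_factor' hK h₁ hgc hgb
  obtain ⟨ha4, -, haN4⟩ := pairing_gradient_factor' hK h₁ hG₁ hgc hgb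
  have ha5 : ∀ i, AEStronglyMeasurable (uncurry fun s x => G₁ s x (ψ x • e i)) (μI.prod μK) ∧
      Integrable (uncurry fun s x => G₁ s x (ψ x • e i)) (μI.prod μK) ∧
      ∫⁻ s, eLpNorm (fun x => G₁ s x (ψ x • e i)) 2 μK ^ (2 : ℝ) ∂μI ≠ ∞ := fun i =>
    pairing_gradient_factor' hK h₁ hG₁ (c := fun x => ψ x • e i) (hψc.smul continuous_const) (Cc := Cψ)
      fun x => by rw [norm_smul, e.orthonormal.1 i, mul_one]; exact hψb x
  have hb5 : ∀ i, AEStronglyMeasurable (uncurry fun s x => G₂ s x (e i)) (μI.prod μK) ∧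
      Integrable (uncurry fun s x => G₂ s x (e i)) (μI.prod μK) ∧
      ∫⁻ s, eLpNorm (fun x => G₂ s x (e i)) 2 μK ^ (2 : ℝ) ∂μI ≠ ∞ := fun i =>
    pairing_gradient_factor' hK h₂ hG₂ (c := fun _ => e i) continuous_const (Cc := 1)
      fun x => by rw [e.orthonormal.1 i]
  obtain ⟨hb8, hb8i, hbN8⟩ := pairing_pressure_factor' hK h₂ hgc hgb
  obtain ⟨hb9, hb9i, hbN9⟩ := pairing_gradient_factor' (c := gradient ψ) hK h₂ hG₂ hgc hgb
  obtain ⟨ha6', haN6', haN7'⟩ := pairing_six_seven_a' hK h₂ hG₂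
  -- `ψ ∇u₂ u₂`
  have hbGU : AEStronglyMeasurable (uncurry fun σ x => ψ x • G₂ σ x (u₂ σ x)) (μI.prod μK) :=
    (hψc.comp continuous_snd).aestronglyMeasurable.smul ha6'
  have hbGUle : ∀ (q : ℝ≥0∞) σ, eLpNorm (fun x => ψ x • G₂ σ x (u₂ σ x)) q μK ≤
      ENNReal.ofReal Cψ * eLpNorm (fun x => G₂ σ x (u₂ σ x)) q μK := fun q σ =>
    eLpNorm_smul_le_of_norm_le hψb _ q
  have hbGUN1 : ∫⁻ σ, eLpNorm (fun x => ψ x • G₂ σ x (u₂ σ x)) 1 μK ^ (2 : ℝ) ∂μI ≠ ∞ :=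
    lintegral_rpow_ne_top_of_le_const_mul ENNReal.ofReal_ne_top (hbGUle 1) (by norm_num) haN6'
  have hbGUN32 : ∫⁻ σ, eLpNorm (fun x => ψ x • G₂ σ x (u₂ σ x)) (ENNReal.ofReal (3 / 2)) μK ∂μI ≠ ∞ := by
    refine ne_top_of_le_ne_top ?_ (lintegral_mono (hbGUle _))
    rw [lintegral_const_mul' _ _ ENNReal.ofReal_ne_top]
    exact ENNReal.mul_ne_top ENNReal.ofReal_ne_top haN7'
  have hu3N : ∫⁻ s, eLpNorm (u₃ s) ∞ μK ^ (2 : ℝ) ∂μI ≠ ∞ :=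
    lintegral_rpow_ne_top_of_ae_le_const_mul (C := 1) ENNReal.one_ne_top
      (hmK.mono fun s hs => by rwa [one_mul]) (by norm_num) hmm2.ne
  -- `L¹` in time of the slice norms
  have l_u2_2 := lintegral_eLpNorm_slice_ne_top_of_rpow hu₂m 2 one_le_two h22
  have l_u2_6 := lintegral_eLpNorm_slice_ne_top_of_rpow hu₂m 6 one_le_two h66
  have l_u2_3 := lintegral_eLpNorm_slice_ne_top_of_rpow hu₂m 3 (by norm_num : (1:ℝ) ≤ 3) h33
  have l_u1_3 := lintegral_eLpNorm_slice_ne_top_of_rpow hu₁m 3 (by norm_num : (1:ℝ) ≤ 3) h1_33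
  have l_u1_2 := lintegral_eLpNorm_slice_ne_top_of_rpow hu₁m 2 one_le_two h1_22
  have l_a2 := lintegral_eLpNorm_slice_ne_top_of_rpow ha2 _ one_le_two haN2
  have l_a3 := lintegral_eLpNorm_slice_ne_top_of_rpow ha3 _ (by norm_num : (1:ℝ) ≤ 3 / 2) haN3
  have l_a4 := lintegral_eLpNorm_slice_ne_top_of_rpow ha4 _ one_le_two haN4
  have l_a5 := fun i => lintegral_eLpNorm_slice_ne_top_of_rpow (ha5 i).1 _ one_le_two (ha5 i).2.2
  have l_b5 := fun i => lintegral_eLpNorm_slice_ne_top_of_rpow (hb5 i).1 _ one_le_two (hb5 i).2.2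
  have l_b8 := lintegral_eLpNorm_slice_ne_top_of_rpow hb8 _ (by norm_num : (1:ℝ) ≤ 3 / 2) hbN8
  have l_b9 := lintegral_eLpNorm_slice_ne_top_of_rpow hb9 _ one_le_two hbN9
  -- a.e. finiteness of the slice norms
  have f_a1 : ∀ᵐ s ∂μI, eLpNorm (fun x => ψ x • G₁ s x (u₃ s x)) 2 μK < ∞ :=
    ae_lt_top' (aemeasurable_eLpNorm_slice ha1 2) haN1
  have f_a2 := ae_eLpNorm_slice_lt_top_of_rpow ha2 _ two_pos haN2
  have f_a3 := ae_eLpNorm_slice_lt_top_of_rpow ha3 _ (by norm_num : (0:ℝ) < 3 / 2) haN3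
  have f_a4 := ae_eLpNorm_slice_lt_top_of_rpow ha4 _ two_pos haN4
  have f_a5 := fun i => ae_eLpNorm_slice_lt_top_of_rpow (ha5 i).1 _ two_pos (ha5 i).2.2
  have f_b5 := fun i => ae_eLpNorm_slice_lt_top_of_rpow (hb5 i).1 _ two_pos (hb5 i).2.2
  have f_u2_2 : ∀ᵐ σ ∂μI, eLpNorm (u₂ σ) 2 μK < ∞ := hbB2.mono fun σ h => h.trans_lt hCb2.lt_top
  have f_u2_6 := ae_eLpNorm_slice_lt_top_of_rpow hu₂m 6 two_pos h66
  have f_u2_3 := ae_eLpNorm_slice_lt_top_of_rpow hu₂m 3 (by norm_num : (0:ℝ) < 3) h33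
  have f_u1_3 := ae_eLpNorm_slice_lt_top_of_rpow hu₁m 3 (by norm_num : (0:ℝ) < 3) h1_33
  have f_u1_2 := ae_eLpNorm_slice_lt_top_of_rpow hu₁m 2 two_pos h1_22
  have f_b8 := ae_eLpNorm_slice_lt_top_of_rpow hb8 _ (by norm_num : (0:ℝ) < 3 / 2) hbN8
  have f_b9 := ae_eLpNorm_slice_lt_top_of_rpow hb9 _ two_pos hbN9
  have f_bGU32 : ∀ᵐ σ ∂μI, eLpNorm (fun x => ψ x • G₂ σ x (u₂ σ x)) (ENNReal.ofReal (3 / 2)) μK < ∞ :=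
    ae_lt_top' (aemeasurable_eLpNorm_slice hbGU _) hbGUN32
  have f_bGU1 := ae_eLpNorm_slice_lt_top_of_rpow hbGU 1 two_pos hbGUN1
  have f_u3 := ae_eLpNorm_slice_lt_top_of_rpow hu₃K ∞ two_pos hu3N
  have f_d3 : ∀ᵐ s ∂μI, eLpNorm (fun x => u₁ s x - u₃ s x) 3 μK < ∞ :=
    hε3.mono fun s h => h.trans_lt ENNReal.ofReal_lt_top
  have hCχ0 : 0 ≤ Cχ := (norm_nonneg _).trans (hχb 0)
  have hbi_u2 := h₂.integrable_prod_restrict hK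
  -- ### the weighted first factors
  obtain ⟨ha1w, haN1w⟩ := pairing_one_a hK h₁ hG₁ hu₃K hmK hm2 hχc hχb hψc hψb
  obtain ⟨ha2w, haN2w⟩ := pairing_two_a hK h₁ hG₁ hu₃K hε3 hχc hχb hψc hψb
  obtain ⟨ha3w, -, haN3w⟩ := pairing_pressure_factor hK h₁ hχc hχb hgc hgb
  obtain ⟨ha4w, -, haN4w⟩ := pairing_gradient_factor (c := gradient ψ) hK h₁ hG₁ hχc hχb hgc hgb
  have ha5w : ∀ i, AEStronglyMeasurable (uncurry fun s x => χ s • G₁ s x (ψ x • e i)) (μI.prod μK) ∧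
      Integrable (uncurry fun s x => χ s • G₁ s x (ψ x • e i)) (μI.prod μK) ∧
      ∫⁻ s, eLpNorm (fun x => χ s • G₁ s x (ψ x • e i)) 2 μK ^ (2 : ℝ) ∂μI ≠ ∞ := fun i =>
    pairing_gradient_factor hK h₁ hG₁ hχc hχb (c := fun x => ψ x • e i) (hψc.smul continuous_const) (Cc := Cψ)
      fun x => by rw [norm_smul, e.orthonormal.1 i, mul_one]; exact hψb x
  obtain ⟨θ, hθc, hθ0', hθ1', hθS, hθz⟩ := exists_continuous_cutoff (half_pos hδ) T
  have hθb : ∀ s, ‖θ s‖ ≤ 1 := fun s => by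
    rw [Real.norm_eq_abs, abs_of_nonneg (hθ0' s)]; exact hθ1' s
  obtain ⟨ha6w, haN6w, haN7w⟩ := pairing_six_seven_a hK h₂ hG₂ hθc hθb
  obtain ⟨ha8w, haN8w, haN9w⟩ := pairing_velocity_a hK h₁ hχc hχb
  obtain ⟨hb6, hbi6, hbN6⟩ := pairing_six_b hK h₁ hu₃K hmK hm2 hε3 hχc hχb hψc hψb
  obtain ⟨hb7, hbi7, hbB7⟩ := pairing_seven_b hK h₁ hu₃K hε3 hχc hχb hψc hψb
  -- supports in time
  have hS1 : ∀ s, s ∉ Icc δ (T - δ) → (fun x => (χ s * ψ x) • G₁ s x (u₃ s x)) = 0 := fun s hs => by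
    funext x; simp [hχ0 s hs]
  have hS2 : ∀ s, s ∉ Icc δ (T - δ) → (fun x => (χ s * ψ x) • G₁ s x (u₁ s x - u₃ s x)) = 0 := fun s hs => by
    funext x; simp [hχ0 s hs]
  have hS3 : ∀ s, s ∉ Icc δ (T - δ) → (fun x => (χ s * p₁ s x) • gradient ψ x) = 0 := fun s hs => by
    funext x; simp [hχ0 s hs]
  have hS4 : ∀ s, s ∉ Icc δ (T - δ) → (fun x => χ s • G₁ s x (gradient ψ x)) = 0 := fun s hs => by
    funext x; simp [hχ0 s hs]
  have hS5 : ∀ i s, s ∉ Icc δ (T - δ) → (fun x => χ s • G₁ s x (ψ x • e i)) = 0 := fun i s hs => by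
    funext x; simp [hχ0 s hs]
  have hS8 : ∀ s, s ∉ Icc δ (T - δ) → (fun x => χ s • u₁ s x) = 0 := fun s hs => by
    funext x; simp [hχ0 s hs]
  have hδ4 : 0 < δ / 2 / 2 := by positivity
  have hS6 : ∀ s, s ∉ Icc (δ / 2 / 2) (T - δ / 2 / 2) → (fun x => θ s • G₂ s x (u₂ s x)) = 0 := fun s hs => by
    funext x
    have : θ s = 0 := hθz s fun h => hs (Ioo_subset_Icc_self h)
    simp [this]
  -- ### the packages
  have P1 := doubledPairing_package_of_ae_le (μ := volume) hφ hδ hK ha1w hS1 hu₂m hbi_u2 2 2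
    (by norm_num) haN1w hCb2 hbB2
  have P2 := doubledPairing_package_of_rpow (μ := volume) hφ hδ hK ha2w hS2 hu₂m hbi_u2
    Real.HolderConjugate.two_two (ENNReal.ofReal (6 / 5)) 6 hne65 haN2w h66
  have P3 := doubledPairing_package_of_rpow (μ := volume) hφ hδ hK ha3w hS3 hu₂m hbi_u2
    h32r (ENNReal.ofReal (3 / 2)) 3 hne32 haN3w h33
  have P4 := doubledPairing_package_of_rpow (μ := volume) hφ hδ hK ha4w hS4 hu₂m hbi_u2
    Real.HolderConjugate.two_two 2 2 (by norm_num) haN4w h22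
  have P5 := fun i => doubledPairing_package_of_rpow (μ := volume) hφ hδ hK (ha5w i).1 (hS5 i) (hb5 i).1
    (hb5 i).2.1 Real.HolderConjugate.two_two 2 2 (by norm_num) (ha5w i).2.2 (hb5 i).2.2
  have P6 := doubledPairing_package_of_rpow (μ := volume) hφ hδ4 hK ha6w hS6 hb6 hbi6
    Real.HolderConjugate.two_two 1 ∞ ENNReal.one_ne_top haN6w hbN6
  have P7 := doubledPairing_package_of_ae_le (μ := volume) hφ hδ4 hK ha6w hS6 hb7 hbi7
    (ENNReal.ofReal (3 / 2)) 3 hne32 haN7w (ENNReal.mul_ne_top ENNReal.ofReal_ne_top ENNReal.ofReal_ne_top) hbB7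
  have P8 := doubledPairing_package_of_rpow (μ := volume) hφ hδ hK ha8w hS8 hb8 hb8i
    h3r 3 (ENNReal.ofReal (3 / 2)) (by norm_num) haN8w hbN8
  have P9 := doubledPairing_package_of_rpow (μ := volume) hφ hδ hK ha8w hS8 hb9 hb9i
    Real.HolderConjugate.two_two 2 2 (by norm_num) haN9w hbN9
  -- ### the `⟪∇u₂ u₂, ψ u₁⟫` term: swap, cut-off, split
  have l_a8 := lintegral_eLpNorm_slice_ne_top_of_rpow ha8w 3 (by norm_num : (1:ℝ) ≤ 3) haN8w
  have In_int := fun n => integrable_doubledPairing (μ := volume) (φ n) ha8w hbGU 3 (ENNReal.ofReal (3 / 2))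
    l_a8 hbGUN32
  have hIn : ∀ᶠ n in atTop, (∫ pr, (φ n).normed volume (pr.2 - pr.1) * (∫ x in K, ⟪χ pr.2 • u₁ pr.2 x, ψ x • G₂ pr.1 x (u₂ pr.1 x)⟫) ∂(μI.prod μI)) =
      (∫ pr, (φ n).normed volume (pr.2 - pr.1) * (∫ x in K, ⟪θ pr.2 • G₂ pr.2 x (u₂ pr.2 x), χ pr.1 • (ψ x • u₃ pr.1 x)⟫) ∂(μI.prod μI)) +
      (∫ pr, (φ n).normed volume (pr.2 - pr.1) * (∫ x in K, ⟪θ pr.2 • G₂ pr.2 x (u₂ pr.2 x), χ pr.1 • (ψ x • (u₁ pr.1 x - u₃ pr.1 x))⟫) ∂(μI.prod μI)) := by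
    have hev : ∀ᶠ n in atTop, (φ n).rOut < δ / 2 := (tendsto_order.1 hφ).2 _ (half_pos hδ)
    filter_upwards [hev] with n hn
    rw [doubledPairing_swap (φ n) T μK (fun s x => χ s • u₁ s x) (fun σ x => ψ x • G₂ σ x (u₂ σ x)),
      doubledPairing_insert_cutoff (φ n) hn hθS hχ0 μK (fun s x => ψ x • G₂ s x (u₂ s x)) u₁]
    have hsum : (∫ pr, (φ n).normed volume (pr.2 - pr.1) * (∫ x in K, ⟪θ pr.2 • G₂ pr.2 x (u₂ pr.2 x), χ pr.1 • (ψ x • u₃ pr.1 x)⟫) ∂(μI.prod μI)) +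
        (∫ pr, (φ n).normed volume (pr.2 - pr.1) * (∫ x in K, ⟪θ pr.2 • G₂ pr.2 x (u₂ pr.2 x), χ pr.1 • (ψ x • (u₁ pr.1 x - u₃ pr.1 x))⟫) ∂(μI.prod μI)) =
        ∫ pr, ((φ n).normed volume (pr.2 - pr.1) * (∫ x in K, ⟪θ pr.2 • G₂ pr.2 x (u₂ pr.2 x), χ pr.1 • (ψ x • u₃ pr.1 x)⟫) +
          (φ n).normed volume (pr.2 - pr.1) * (∫ x in K, ⟪θ pr.2 • G₂ pr.2 x (u₂ pr.2 x), χ pr.1 • (ψ x • (u₁ pr.1 x - u₃ pr.1 x))⟫)) ∂(μI.prod μI) := (integral_add (P6.2.1 n) (P7.2.1 n)).symm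
    rw [hsum]
    refine integral_congr_ae ?_
    filter_upwards [P6.2.2.2.1, P7.2.2.2.1] with pr i6 i7
    rw [← mul_add, ← integral_add i6 i7]
    congr 1
    refine integral_congr_ae (Eventually.of_forall fun x => ?_)
    simp only
    rw [← inner_add_right, ← smul_add, ← smul_add, add_sub_cancel]
    simp only [real_inner_smul_left, real_inner_smul_right]
    ring
  have hI : Tendsto (fun n => (∫ pr, (φ n).normed volume (pr.2 - pr.1) * (∫ x in K, ⟪χ pr.2 • u₁ pr.2 x, ψ x • G₂ pr.1 x (u₂ pr.1 x)⟫) ∂(μI.prod μI))) atTop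
      (𝓝 ((∫ z, ⟪θ z.1 • G₂ z.1 z.2 (u₂ z.1 z.2), χ z.1 • (ψ z.2 • u₃ z.1 z.2)⟫ ∂(μI.prod μK)) +
        (∫ z, ⟪θ z.1 • G₂ z.1 z.2 (u₂ z.1 z.2), χ z.1 • (ψ z.2 • (u₁ z.1 z.2 - u₃ z.1 z.2))⟫ ∂(μI.prod μK)))) :=
    (P6.1.add P7.1).congr' (hIn.mono fun n hn => hn.symm)
  -- ### the joint identities (weighted)
  have xi1 := ae_integrable_inner_slices (μ := volume) ha1 hu₂m 2 2 f_a1 f_u2_2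
  have xi2 := ae_integrable_inner_slices (μ := volume) ha2 hu₂m (ENNReal.ofReal (6 / 5)) 6 f_a2 f_u2_6
  have xi4 := ae_integrable_inner_slices (μ := volume) ha4 hu₂m 2 2 f_a4 f_u2_2
  have xi5 := fun i => ae_integrable_inner_slices (μ := volume) (ha5 i).1 (hb5 i).1 2 2 (f_a5 i) (f_b5 i)
  have xig3 := ae_integrable_inner_slices (μ := volume) hu₁m hb9 2 2 f_u1_2 f_b9
  have hdec_pt : ∀ n, ∀ᵐ p ∂(μI.prod μI),
      (φ n).normed volume (p.2 - p.1) * χ p.2 *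
        ((((-∫ x, ⟪G₁ p.2 x (u₁ p.2 x), ψ x • u₂ p.1 x⟫) + ∫ x, p₁ p.2 x * fderiv ℝ ψ x (u₂ p.1 x)) -
          ν * ∫ x, ∑ i, ⟪G₁ p.2 x (stdOrthonormalBasis ℝ (EuclideanSpace ℝ (Fin 3)) i),
            fderiv ℝ ψ x (stdOrthonormalBasis ℝ (EuclideanSpace ℝ (Fin 3)) i) • u₂ p.1 x + ψ x • G₂ p.1 x (stdOrthonormalBasis ℝ (EuclideanSpace ℝ (Fin 3)) i)⟫) +
         (((-∫ x, ⟪G₂ p.1 x (u₂ p.1 x), ψ x • u₁ p.2 x⟫) + ∫ x, p₂ p.1 x * fderiv ℝ ψ x (u₁ p.2 x)) -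
          ν * ∫ x, ∑ i, ⟪G₂ p.1 x (stdOrthonormalBasis ℝ (EuclideanSpace ℝ (Fin 3)) i),
            fderiv ℝ ψ x (stdOrthonormalBasis ℝ (EuclideanSpace ℝ (Fin 3)) i) • u₁ p.2 x + ψ x • G₁ p.2 x (stdOrthonormalBasis ℝ (EuclideanSpace ℝ (Fin 3)) i)⟫)) =
      (((-((φ n).normed volume (p.2 - p.1) * (∫ x in K, ⟪(χ p.2 * ψ x) • G₁ p.2 x (u₃ p.2 x), u₂ p.1 x⟫) +
            (φ n).normed volume (p.2 - p.1) * (∫ x in K, ⟪(χ p.2 * ψ x) • G₁ p.2 x (u₁ p.2 x - u₃ p.2 x), u₂ p.1 x⟫))) +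
          (φ n).normed volume (p.2 - p.1) * (∫ x in K, ⟪(χ p.2 * p₁ p.2 x) • gradient ψ x, u₂ p.1 x⟫)) -
        ν * ((φ n).normed volume (p.2 - p.1) * (∫ x in K, ⟪χ p.2 • G₁ p.2 x (gradient ψ x), u₂ p.1 x⟫) +
          ∑ i, (φ n).normed volume (p.2 - p.1) * (∫ x in K, ⟪χ p.2 • G₁ p.2 x (ψ x • e i), G₂ p.1 x (e i)⟫))) +
      (((-((φ n).normed volume (p.2 - p.1) * (∫ x in K, ⟪χ p.2 • u₁ p.2 x, ψ x • G₂ p.1 x (u₂ p.1 x)⟫))) +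
          (φ n).normed volume (p.2 - p.1) * (∫ x in K, ⟪χ p.2 • u₁ p.2 x, p₂ p.1 x • gradient ψ x⟫)) -
        ν * ((φ n).normed volume (p.2 - p.1) * (∫ x in K, ⟪χ p.2 • u₁ p.2 x, G₂ p.1 x (gradient ψ x)⟫) +
          ∑ i, (φ n).normed volume (p.2 - p.1) * (∫ x in K, ⟪χ p.2 • G₁ p.2 x (ψ x • e i), G₂ p.1 x (e i)⟫))) := by
    intro n
    filter_upwards [xi1, xi2, xi4, ae_all_iff.2 xi5, xig3] with p i1 i2 i4 i5 ig3
    rw [cross_density_f_eq ν i1 i2 i4 i5, cross_density_g_eq ν ig3 i5]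
    have eW1 : (∫ x in K, ⟪(χ p.2 * ψ x) • G₁ p.2 x (u₃ p.2 x), u₂ p.1 x⟫) = χ p.2 * ∫ x in K, ⟪ψ x • G₁ p.2 x (u₃ p.2 x), u₂ p.1 x⟫ := by
      rw [const_mul_integral_inner]
      refine integral_congr_ae (Eventually.of_forall fun x => ?_); simp only [smul_smul]
    have eW2 : (∫ x in K, ⟪(χ p.2 * ψ x) • G₁ p.2 x (u₁ p.2 x - u₃ p.2 x), u₂ p.1 x⟫) = χ p.2 * ∫ x in K, ⟪ψ x • G₁ p.2 x (u₁ p.2 x - u₃ p.2 x), u₂ p.1 x⟫ := by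
      rw [const_mul_integral_inner]
      refine integral_congr_ae (Eventually.of_forall fun x => ?_); simp only [smul_smul]
    have eW3 : (∫ x in K, ⟪(χ p.2 * p₁ p.2 x) • gradient ψ x, u₂ p.1 x⟫) = χ p.2 * ∫ x in K, ⟪p₁ p.2 x • gradient ψ x, u₂ p.1 x⟫ := by
      rw [const_mul_integral_inner]
      refine integral_congr_ae (Eventually.of_forall fun x => ?_); simp only [smul_smul]
    have eW4 : (∫ x in K, ⟪χ p.2 • G₁ p.2 x (gradient ψ x), u₂ p.1 x⟫) = χ p.2 * ∫ x in K, ⟪G₁ p.2 x (gradient ψ x), u₂ p.1 x⟫ := by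
      rw [const_mul_integral_inner]
    have eW5 : ∀ i, (∫ x in K, ⟪χ p.2 • G₁ p.2 x (ψ x • e i), G₂ p.1 x (e i)⟫) = χ p.2 * ∫ x in K, ⟪G₁ p.2 x (ψ x • e i), G₂ p.1 x (e i)⟫ := fun i => by
      rw [const_mul_integral_inner]
    have eWI : (∫ x in K, ⟪χ p.2 • u₁ p.2 x, ψ x • G₂ p.1 x (u₂ p.1 x)⟫) = χ p.2 * ∫ x in K, ⟪u₁ p.2 x, ψ x • G₂ p.1 x (u₂ p.1 x)⟫ := by
      rw [const_mul_integral_inner]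
    have eW8 : (∫ x in K, ⟪χ p.2 • u₁ p.2 x, p₂ p.1 x • gradient ψ x⟫) = χ p.2 * ∫ x in K, ⟪u₁ p.2 x, p₂ p.1 x • gradient ψ x⟫ := by
      rw [const_mul_integral_inner]
    have eW9 : (∫ x in K, ⟪χ p.2 • u₁ p.2 x, G₂ p.1 x (gradient ψ x)⟫) = χ p.2 * ∫ x in K, ⟪u₁ p.2 x, G₂ p.1 x (gradient ψ x)⟫ := by
      rw [const_mul_integral_inner]
    rw [eW1, eW2, eW3, eW4, eWI, eW8, eW9]
    simp_rw [eW5]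
    rw [← Finset.mul_sum, ← Finset.mul_sum]
    ring
  -- ### the decomposition of the doubled integral at stage `n`
  have hdec : ∀ n, ∫ p, (φ n).normed volume (p.2 - p.1) * χ p.2 *
        ((((-∫ x, ⟪G₁ p.2 x (u₁ p.2 x), ψ x • u₂ p.1 x⟫) + ∫ x, p₁ p.2 x * fderiv ℝ ψ x (u₂ p.1 x)) -
          ν * ∫ x, ∑ i, ⟪G₁ p.2 x (stdOrthonormalBasis ℝ (EuclideanSpace ℝ (Fin 3)) i),
            fderiv ℝ ψ x (stdOrthonormalBasis ℝ (EuclideanSpace ℝ (Fin 3)) i) • u₂ p.1 x + ψ x • G₂ p.1 x (stdOrthonormalBasis ℝ (EuclideanSpace ℝ (Fin 3)) i)⟫) +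
         (((-∫ x, ⟪G₂ p.1 x (u₂ p.1 x), ψ x • u₁ p.2 x⟫) + ∫ x, p₂ p.1 x * fderiv ℝ ψ x (u₁ p.2 x)) -
          ν * ∫ x, ∑ i, ⟪G₂ p.1 x (stdOrthonormalBasis ℝ (EuclideanSpace ℝ (Fin 3)) i),
            fderiv ℝ ψ x (stdOrthonormalBasis ℝ (EuclideanSpace ℝ (Fin 3)) i) • u₁ p.2 x + ψ x • G₁ p.2 x (stdOrthonormalBasis ℝ (EuclideanSpace ℝ (Fin 3)) i)⟫)) ∂(μI.prod μI) =
      (((-((∫ pr, (φ n).normed volume (pr.2 - pr.1) * (∫ x in K, ⟪(χ pr.2 * ψ x) • G₁ pr.2 x (u₃ pr.2 x), u₂ pr.1 x⟫) ∂(μI.prod μI)) + (∫ pr, (φ n).normed volume (pr.2 - pr.1) * (∫ x in K, ⟪(χ pr.2 * ψ x) • G₁ pr.2 x (u₁ pr.2 x - u₃ pr.2 x), u₂ pr.1 x⟫) ∂(μI.prod μI)))) + (∫ pr, (φ n).normed volume (pr.2 - pr.1) * (∫ x in K, ⟪(χ pr.2 * p₁ pr.2 x) • gradient ψ x, u₂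 pr.1 x⟫) ∂(μI.prod μI))) -
        ν * ((∫ pr, (φ n).normed volume (pr.2 - pr.1) * (∫ x in K, ⟪χ pr.2 • G₁ pr.2 x (gradient ψ x), u₂ pr.1 x⟫) ∂(μI.prod μI)) + ∑ i, (∫ pr, (φ n).normed volume (pr.2 - pr.1) * (∫ x in K, ⟪χ pr.2 • G₁ pr.2 x (ψ x • e i), G₂ pr.1 x (e i)⟫) ∂(μI.prod μI)))) +
      (((-(∫ pr, (φ n).normed volume (pr.2 - pr.1) * (∫ x in K, ⟪χ pr.2 • u₁ pr.2 x, ψ x • G₂ pr.1 x (u₂ pr.1 x)⟫) ∂(μI.prod μI))) + (∫ pr, (φ n).normed volume (pr.2 - pr.1) * (∫ x in K, ⟪χ pr.2 • u₁ pr.2 x, p₂ pr.1 x • gradient ψ x⟫) ∂(μI.prod μI))) -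
        ν * ((∫ pr, (φ n).normed volume (pr.2 - pr.1) * (∫ x in K, ⟪χ pr.2 • u₁ pr.2 x, G₂ pr.1 x (gradient ψ x)⟫) ∂(μI.prod μI)) + ∑ i, (∫ pr, (φ n).normed volume (pr.2 - pr.1) * (∫ x in K, ⟪χ pr.2 • G₁ pr.2 x (ψ x • e i), G₂ pr.1 x (e i)⟫) ∂(μI.prod μI)))) := by
    intro n
    have i1 : Integrable (fun pr : ℝ × ℝ => (φ n).normed volume (pr.2 - pr.1) * (∫ x in K, ⟪(χ pr.2 * ψ x) • G₁ pr.2 x (u₃ pr.2 x), u₂ pr.1 x⟫)) (μI.prod μI) := P1.2.1 n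
    have i2 : Integrable (fun pr : ℝ × ℝ => (φ n).normed volume (pr.2 - pr.1) * (∫ x in K, ⟪(χ pr.2 * ψ x) • G₁ pr.2 x (u₁ pr.2 x - u₃ pr.2 x), u₂ pr.1 x⟫)) (μI.prod μI) := P2.2.1 n
    have i3 : Integrable (fun pr : ℝ × ℝ => (φ n).normed volume (pr.2 - pr.1) * (∫ x in K, ⟪(χ pr.2 * p₁ pr.2 x) • gradient ψ x, u₂ pr.1 x⟫)) (μI.prod μI) := P3.2.1 n
    have i4 : Integrable (fun pr : ℝ × ℝ => (φ n).normed volume (pr.2 - pr.1) * (∫ x in K, ⟪χ pr.2 • G₁ pr.2 x (gradient ψ x), u₂ pr.1 x⟫)) (μI.prod μI) := P4.2.1 n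
    have i5 : Integrable (fun pr : ℝ × ℝ => ∑ i, (φ n).normed volume (pr.2 - pr.1) * (∫ x in K, ⟪χ pr.2 • G₁ pr.2 x (ψ x • e i), G₂ pr.1 x (e i)⟫)) (μI.prod μI) :=
      integrable_finsetSum _ fun i _ => (P5 i).2.1 n
    have iI : Integrable (fun pr : ℝ × ℝ => (φ n).normed volume (pr.2 - pr.1) * (∫ x in K, ⟪χ pr.2 • u₁ pr.2 x, ψ x • G₂ pr.1 x (u₂ pr.1 x)⟫)) (μI.prod μI) := In_int n
    have i8 : Integrable (fun pr : ℝ × ℝ => (φ n).normed volume (pr.2 - pr.1) * (∫ x in K, ⟪χ pr.2 • u₁ pr.2 x, p₂ pr.1 x • gradient ψ x⟫)) (μI.prod μI) := P8.2.1 n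
    have i9 : Integrable (fun pr : ℝ × ℝ => (φ n).normed volume (pr.2 - pr.1) * (∫ x in K, ⟪χ pr.2 • u₁ pr.2 x, G₂ pr.1 x (gradient ψ x)⟫)) (μI.prod μI) := P9.2.1 n
    have i12 : Integrable (fun pr : ℝ × ℝ => -((φ n).normed volume (pr.2 - pr.1) * (∫ x in K, ⟪(χ pr.2 * ψ x) • G₁ pr.2 x (u₃ pr.2 x), u₂ pr.1 x⟫) +
        (φ n).normed volume (pr.2 - pr.1) * (∫ x in K, ⟪(χ pr.2 * ψ x) • G₁ pr.2 x (u₁ pr.2 x - u₃ pr.2 x), u₂ pr.1 x⟫))) (μI.prod μI) := (i1.add i2).neg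
    have i123 : Integrable (fun pr : ℝ × ℝ => (-((φ n).normed volume (pr.2 - pr.1) * (∫ x in K, ⟪(χ pr.2 * ψ x) • G₁ pr.2 x (u₃ pr.2 x), u₂ pr.1 x⟫) +
        (φ n).normed volume (pr.2 - pr.1) * (∫ x in K, ⟪(χ pr.2 * ψ x) • G₁ pr.2 x (u₁ pr.2 x - u₃ pr.2 x), u₂ pr.1 x⟫))) + (φ n).normed volume (pr.2 - pr.1) * (∫ x in K, ⟪(χ pr.2 * p₁ pr.2 x) • gradient ψ x, u₂ pr.1 x⟫)) (μI.prod μI) := i12.add i3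
    have i45 : Integrable (fun pr : ℝ × ℝ => ν * ((φ n).normed volume (pr.2 - pr.1) * (∫ x in K, ⟪χ pr.2 • G₁ pr.2 x (gradient ψ x), u₂ pr.1 x⟫) +
        ∑ i, (φ n).normed volume (pr.2 - pr.1) * (∫ x in K, ⟪χ pr.2 • G₁ pr.2 x (ψ x • e i), G₂ pr.1 x (e i)⟫))) (μI.prod μI) := (i4.add i5).const_mul ν
    have iX : Integrable (fun pr : ℝ × ℝ => ((-((φ n).normed volume (pr.2 - pr.1) * (∫ x in K, ⟪(χ pr.2 * ψ x) • G₁ pr.2 x (u₃ pr.2 x), u₂ pr.1 x⟫) +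
        (φ n).normed volume (pr.2 - pr.1) * (∫ x in K, ⟪(χ pr.2 * ψ x) • G₁ pr.2 x (u₁ pr.2 x - u₃ pr.2 x), u₂ pr.1 x⟫))) + (φ n).normed volume (pr.2 - pr.1) * (∫ x in K, ⟪(χ pr.2 * p₁ pr.2 x) • gradient ψ x, u₂ pr.1 x⟫)) -
        ν * ((φ n).normed volume (pr.2 - pr.1) * (∫ x in K, ⟪χ pr.2 • G₁ pr.2 x (gradient ψ x), u₂ pr.1 x⟫) + ∑ i, (φ n).normed volume (pr.2 - pr.1) * (∫ x in K, ⟪χ pr.2 • G₁ pr.2 x (ψ x • e i), G₂ pr.1 x (e i)⟫))) (μI.prod μI) := i123.sub i45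
    have iI8 : Integrable (fun pr : ℝ × ℝ => (-((φ n).normed volume (pr.2 - pr.1) * (∫ x in K, ⟪χ pr.2 • u₁ pr.2 x, ψ x • G₂ pr.1 x (u₂ pr.1 x)⟫))) +
        (φ n).normed volume (pr.2 - pr.1) * (∫ x in K, ⟪χ pr.2 • u₁ pr.2 x, p₂ pr.1 x • gradient ψ x⟫)) (μI.prod μI) := iI.neg.add i8
    have i95 : Integrable (fun pr : ℝ × ℝ => ν * ((φ n).normed volume (pr.2 - pr.1) * (∫ x in K, ⟪χ pr.2 • u₁ pr.2 x, G₂ pr.1 x (gradient ψ x)⟫) +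
        ∑ i, (φ n).normed volume (pr.2 - pr.1) * (∫ x in K, ⟪χ pr.2 • G₁ pr.2 x (ψ x • e i), G₂ pr.1 x (e i)⟫))) (μI.prod μI) := (i9.add i5).const_mul ν
    have iY : Integrable (fun pr : ℝ × ℝ => ((-((φ n).normed volume (pr.2 - pr.1) * (∫ x in K, ⟪χ pr.2 • u₁ pr.2 x, ψ x • G₂ pr.1 x (u₂ pr.1 x)⟫))) + (φ n).normed volume (pr.2 - pr.1) * (∫ x in K, ⟪χ pr.2 • u₁ pr.2 x, p₂ pr.1 x • gradient ψ x⟫)) -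
        ν * ((φ n).normed volume (pr.2 - pr.1) * (∫ x in K, ⟪χ pr.2 • u₁ pr.2 x, G₂ pr.1 x (gradient ψ x)⟫) + ∑ i, (φ n).normed volume (pr.2 - pr.1) * (∫ x in K, ⟪χ pr.2 • G₁ pr.2 x (ψ x • e i), G₂ pr.1 x (e i)⟫))) (μI.prod μI) := iI8.sub i95
    have e0 := integral_congr_ae (hdec_pt n)
    have eXY : ∫ pr : ℝ × ℝ, ((((-((φ n).normed volume (pr.2 - pr.1) * (∫ x in K, ⟪(χ pr.2 * ψ x) • G₁ pr.2 x (u₃ pr.2 x), u₂ pr.1 x⟫) +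
        (φ n).normed volume (pr.2 - pr.1) * (∫ x in K, ⟪(χ pr.2 * ψ x) • G₁ pr.2 x (u₁ pr.2 x - u₃ pr.2 x), u₂ pr.1 x⟫))) + (φ n).normed volume (pr.2 - pr.1) * (∫ x in K, ⟪(χ pr.2 * p₁ pr.2 x) • gradient ψ x, u₂ pr.1 x⟫)) -
        ν * ((φ n).normed volume (pr.2 - pr.1) * (∫ x in K, ⟪χ pr.2 • G₁ pr.2 x (gradient ψ x), u₂ pr.1 x⟫) + ∑ i, (φ n).normed volume (pr.2 - pr.1) * (∫ x in K, ⟪χ pr.2 • G₁ pr.2 x (ψ x • e i), G₂ pr.1 x (e i)⟫))) +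
        (((-((φ n).normed volume (pr.2 - pr.1) * (∫ x in K, ⟪χ pr.2 • u₁ pr.2 x, ψ x • G₂ pr.1 x (u₂ pr.1 x)⟫))) + (φ n).normed volume (pr.2 - pr.1) * (∫ x in K, ⟪χ pr.2 • u₁ pr.2 x, p₂ pr.1 x • gradient ψ x⟫)) -
        ν * ((φ n).normed volume (pr.2 - pr.1) * (∫ x in K, ⟪χ pr.2 • u₁ pr.2 x, G₂ pr.1 x (gradient ψ x)⟫) + ∑ i, (φ n).normed volume (pr.2 - pr.1) * (∫ x in K, ⟪χ pr.2 • G₁ pr.2 x (ψ x • e i), G₂ pr.1 x (e i)⟫)))) ∂(μI.prod μI) =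
        (∫ pr : ℝ × ℝ, ((-((φ n).normed volume (pr.2 - pr.1) * (∫ x in K, ⟪(χ pr.2 * ψ x) • G₁ pr.2 x (u₃ pr.2 x), u₂ pr.1 x⟫) +
        (φ n).normed volume (pr.2 - pr.1) * (∫ x in K, ⟪(χ pr.2 * ψ x) • G₁ pr.2 x (u₁ pr.2 x - u₃ pr.2 x), u₂ pr.1 x⟫))) + (φ n).normed volume (pr.2 - pr.1) * (∫ x in K, ⟪(χ pr.2 * p₁ pr.2 x) • gradient ψ x, u₂ pr.1 x⟫)) -
        ν * ((φ n).normed volume (pr.2 - pr.1) * (∫ x in K, ⟪χ pr.2 • G₁ pr.2 x (gradient ψ x), u₂ pr.1 x⟫) + ∑ i, (φ n).normed volume (pr.2 - pr.1) * (∫ x in K, ⟪χ pr.2 • G₁ pr.2 x (ψ x • e i), G₂ pr.1 x (e i)⟫)) ∂(μI.prod μI)) +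
        ∫ pr : ℝ × ℝ, ((-((φ n).normed volume (pr.2 - pr.1) * (∫ x in K, ⟪χ pr.2 • u₁ pr.2 x, ψ x • G₂ pr.1 x (u₂ pr.1 x)⟫))) + (φ n).normed volume (pr.2 - pr.1) * (∫ x in K, ⟪χ pr.2 • u₁ pr.2 x, p₂ pr.1 x • gradient ψ x⟫)) -
        ν * ((φ n).normed volume (pr.2 - pr.1) * (∫ x in K, ⟪χ pr.2 • u₁ pr.2 x, G₂ pr.1 x (gradient ψ x)⟫) + ∑ i, (φ n).normed volume (pr.2 - pr.1) * (∫ x in K, ⟪χ pr.2 • G₁ pr.2 x (ψ x • e i), G₂ pr.1 x (e i)⟫)) ∂(μI.prod μI) := integral_add iX iY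
    have eX1 : ∫ pr : ℝ × ℝ, ((-((φ n).normed volume (pr.2 - pr.1) * (∫ x in K, ⟪(χ pr.2 * ψ x) • G₁ pr.2 x (u₃ pr.2 x), u₂ pr.1 x⟫) +
        (φ n).normed volume (pr.2 - pr.1) * (∫ x in K, ⟪(χ pr.2 * ψ x) • G₁ pr.2 x (u₁ pr.2 x - u₃ pr.2 x), u₂ pr.1 x⟫))) + (φ n).normed volume (pr.2 - pr.1) * (∫ x in K, ⟪(χ pr.2 * p₁ pr.2 x) • gradient ψ x, u₂ pr.1 x⟫)) -
        ν * ((φ n).normed volume (pr.2 - pr.1) * (∫ x in K, ⟪χ pr.2 • G₁ pr.2 x (gradient ψ x), u₂ pr.1 x⟫) + ∑ i, (φ n).normed volume (pr.2 - pr.1) * (∫ x in K, ⟪χ pr.2 • G₁ pr.2 x (ψ x • e i), G₂ pr.1 x (e i)⟫)) ∂(μI.prod μI) =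
        (∫ pr : ℝ × ℝ, (-((φ n).normed volume (pr.2 - pr.1) * (∫ x in K, ⟪(χ pr.2 * ψ x) • G₁ pr.2 x (u₃ pr.2 x), u₂ pr.1 x⟫) +
        (φ n).normed volume (pr.2 - pr.1) * (∫ x in K, ⟪(χ pr.2 * ψ x) • G₁ pr.2 x (u₁ pr.2 x - u₃ pr.2 x), u₂ pr.1 x⟫))) + (φ n).normed volume (pr.2 - pr.1) * (∫ x in K, ⟪(χ pr.2 * p₁ pr.2 x) • gradient ψ x, u₂ pr.1 x⟫) ∂(μI.prod μI)) -
        ∫ pr : ℝ × ℝ, ν * ((φ n).normed volume (pr.2 - pr.1) * (∫ x in K, ⟪χ pr.2 • G₁ pr.2 x (gradient ψ x), u₂ pr.1 x⟫) + ∑ i, (φ n).normed volume (pr.2 - pr.1) * (∫ x in K, ⟪χ pr.2 • G₁ pr.2 x (ψ x • e i), G₂ pr.1 x (e i)⟫)) ∂(μI.prod μI) := integral_sub i123 i45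
    have eX2 : ∫ pr : ℝ × ℝ, (-((φ n).normed volume (pr.2 - pr.1) * (∫ x in K, ⟪(χ pr.2 * ψ x) • G₁ pr.2 x (u₃ pr.2 x), u₂ pr.1 x⟫) +
        (φ n).normed volume (pr.2 - pr.1) * (∫ x in K, ⟪(χ pr.2 * ψ x) • G₁ pr.2 x (u₁ pr.2 x - u₃ pr.2 x), u₂ pr.1 x⟫))) + (φ n).normed volume (pr.2 - pr.1) * (∫ x in K, ⟪(χ pr.2 * p₁ pr.2 x) • gradient ψ x, u₂ pr.1 x⟫) ∂(μI.prod μI) =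
        (∫ pr : ℝ × ℝ, -((φ n).normed volume (pr.2 - pr.1) * (∫ x in K, ⟪(χ pr.2 * ψ x) • G₁ pr.2 x (u₃ pr.2 x), u₂ pr.1 x⟫) +
        (φ n).normed volume (pr.2 - pr.1) * (∫ x in K, ⟪(χ pr.2 * ψ x) • G₁ pr.2 x (u₁ pr.2 x - u₃ pr.2 x), u₂ pr.1 x⟫)) ∂(μI.prod μI)) + (∫ pr, (φ n).normed volume (pr.2 - pr.1) * (∫ x in K, ⟪(χ pr.2 * p₁ pr.2 x) • gradient ψ x, u₂ pr.1 x⟫) ∂(μI.prod μI)) := integral_add i12 i3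
    have eX3 : ∫ pr : ℝ × ℝ, -((φ n).normed volume (pr.2 - pr.1) * (∫ x in K, ⟪(χ pr.2 * ψ x) • G₁ pr.2 x (u₃ pr.2 x), u₂ pr.1 x⟫) +
        (φ n).normed volume (pr.2 - pr.1) * (∫ x in K, ⟪(χ pr.2 * ψ x) • G₁ pr.2 x (u₁ pr.2 x - u₃ pr.2 x), u₂ pr.1 x⟫)) ∂(μI.prod μI) = -∫ pr : ℝ × ℝ, ((φ n).normed volume (pr.2 - pr.1) * (∫ x in K, ⟪(χ pr.2 * ψ x) • G₁ pr.2 x (u₃ pr.2 x), u₂ pr.1 x⟫) +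
        (φ n).normed volume (pr.2 - pr.1) * (∫ x in K, ⟪(χ pr.2 * ψ x) • G₁ pr.2 x (u₁ pr.2 x - u₃ pr.2 x), u₂ pr.1 x⟫)) ∂(μI.prod μI) := integral_neg _
    have eX4 : ∫ pr : ℝ × ℝ, ((φ n).normed volume (pr.2 - pr.1) * (∫ x in K, ⟪(χ pr.2 * ψ x) • G₁ pr.2 x (u₃ pr.2 x), u₂ pr.1 x⟫) +
        (φ n).normed volume (pr.2 - pr.1) * (∫ x in K, ⟪(χ pr.2 * ψ x) • G₁ pr.2 x (u₁ pr.2 x - u₃ pr.2 x), u₂ pr.1 x⟫)) ∂(μI.prod μI) = (∫ pr, (φ n).normed volume (pr.2 - pr.1) * (∫ x in K, ⟪(χ pr.2 * ψ x) • G₁ pr.2 x (u₃ pr.2 x), u₂ pr.1 x⟫) ∂(μI.prod μI)) + (∫ pr, (φ n).normed volume (pr.2 - pr.1) * (∫ x in K, ⟪(χ pr.2 * ψ x) • G₁ pr.2 x (u₁ pr.2 x - u₃ pr.2 x), u₂ pr.1 x⟫) ∂(μI.prod μI)) := integral_add i1 i2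
    have eX5 : ∫ pr : ℝ × ℝ, ν * ((φ n).normed volume (pr.2 - pr.1) * (∫ x in K, ⟪χ pr.2 • G₁ pr.2 x (gradient ψ x), u₂ pr.1 x⟫) + ∑ i, (φ n).normed volume (pr.2 - pr.1) * (∫ x in K, ⟪χ pr.2 • G₁ pr.2 x (ψ x • e i), G₂ pr.1 x (e i)⟫)) ∂(μI.prod μI) =
        ν * ∫ pr : ℝ × ℝ, ((φ n).normed volume (pr.2 - pr.1) * (∫ x in K, ⟪χ pr.2 • G₁ pr.2 x (gradient ψ x), u₂ pr.1 x⟫) + ∑ i, (φ n).normed volume (pr.2 - pr.1) * (∫ x in K, ⟪χ pr.2 • G₁ pr.2 x (ψ x • e i), G₂ pr.1 x (e i)⟫)) ∂(μI.prod μI) := integral_const_mul _ _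
    have eX6 : ∫ pr : ℝ × ℝ, ((φ n).normed volume (pr.2 - pr.1) * (∫ x in K, ⟪χ pr.2 • G₁ pr.2 x (gradient ψ x), u₂ pr.1 x⟫) + ∑ i, (φ n).normed volume (pr.2 - pr.1) * (∫ x in K, ⟪χ pr.2 • G₁ pr.2 x (ψ x • e i), G₂ pr.1 x (e i)⟫)) ∂(μI.prod μI) =
        (∫ pr, (φ n).normed volume (pr.2 - pr.1) * (∫ x in K, ⟪χ pr.2 • G₁ pr.2 x (gradient ψ x), u₂ pr.1 x⟫) ∂(μI.prod μI)) + ∫ pr : ℝ × ℝ, ∑ i, (φ n).normed volume (pr.2 - pr.1) * (∫ x in K, ⟪χ pr.2 • G₁ pr.2 x (ψ x • e i), G₂ pr.1 x (e i)⟫) ∂(μI.prod μI) := integral_add i4 i5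
    have eX7 : ∫ pr : ℝ × ℝ, ∑ i, (φ n).normed volume (pr.2 - pr.1) * (∫ x in K, ⟪χ pr.2 • G₁ pr.2 x (ψ x • e i), G₂ pr.1 x (e i)⟫) ∂(μI.prod μI) = ∑ i, (∫ pr, (φ n).normed volume (pr.2 - pr.1) * (∫ x in K, ⟪χ pr.2 • G₁ pr.2 x (ψ x • e i), G₂ pr.1 x (e i)⟫) ∂(μI.prod μI)) :=
      integral_finsetSum _ fun i _ => (P5 i).2.1 n
    have eY1 : ∫ pr : ℝ × ℝ, ((-((φ n).normed volume (pr.2 - pr.1) * (∫ x in K, ⟪χ pr.2 • u₁ pr.2 x, ψ x • G₂ pr.1 x (u₂ pr.1 x)⟫))) + (φ n).normed volume (pr.2 - pr.1) * (∫ x in K, ⟪χ pr.2 • u₁ pr.2 x, p₂ pr.1 x • gradient ψ x⟫)) -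
        ν * ((φ n).normed volume (pr.2 - pr.1) * (∫ x in K, ⟪χ pr.2 • u₁ pr.2 x, G₂ pr.1 x (gradient ψ x)⟫) + ∑ i, (φ n).normed volume (pr.2 - pr.1) * (∫ x in K, ⟪χ pr.2 • G₁ pr.2 x (ψ x • e i), G₂ pr.1 x (e i)⟫)) ∂(μI.prod μI) =
        (∫ pr : ℝ × ℝ, (-((φ n).normed volume (pr.2 - pr.1) * (∫ x in K, ⟪χ pr.2 • u₁ pr.2 x, ψ x • G₂ pr.1 x (u₂ pr.1 x)⟫))) + (φ n).normed volume (pr.2 - pr.1) * (∫ x in K, ⟪χ pr.2 • u₁ pr.2 x, p₂ pr.1 x • gradient ψ x⟫) ∂(μI.prod μI)) -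
        ∫ pr : ℝ × ℝ, ν * ((φ n).normed volume (pr.2 - pr.1) * (∫ x in K, ⟪χ pr.2 • u₁ pr.2 x, G₂ pr.1 x (gradient ψ x)⟫) + ∑ i, (φ n).normed volume (pr.2 - pr.1) * (∫ x in K, ⟪χ pr.2 • G₁ pr.2 x (ψ x • e i), G₂ pr.1 x (e i)⟫)) ∂(μI.prod μI) := integral_sub iI8 i95
    have eY2 : ∫ pr : ℝ × ℝ, (-((φ n).normed volume (pr.2 - pr.1) * (∫ x in K, ⟪χ pr.2 • u₁ pr.2 x, ψ x • G₂ pr.1 x (u₂ pr.1 x)⟫))) + (φ n).normed volume (pr.2 - pr.1) * (∫ x in K, ⟪χ pr.2 • u₁ pr.2 x, p₂ pr.1 x • gradient ψ x⟫) ∂(μI.prod μI) =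
        (∫ pr : ℝ × ℝ, -((φ n).normed volume (pr.2 - pr.1) * (∫ x in K, ⟪χ pr.2 • u₁ pr.2 x, ψ x • G₂ pr.1 x (u₂ pr.1 x)⟫)) ∂(μI.prod μI)) + (∫ pr, (φ n).normed volume (pr.2 - pr.1) * (∫ x in K, ⟪χ pr.2 • u₁ pr.2 x, p₂ pr.1 x • gradient ψ x⟫) ∂(μI.prod μI)) := integral_add iI.neg i8
    have eY3 : ∫ pr : ℝ × ℝ, -((φ n).normed volume (pr.2 - pr.1) * (∫ x in K, ⟪χ pr.2 • u₁ pr.2 x, ψ x • G₂ pr.1 x (u₂ pr.1 x)⟫)) ∂(μI.prod μI) = -(∫ pr, (φ n).normed volume (pr.2 - pr.1) * (∫ x in K, ⟪χ pr.2 • u₁ pr.2 x, ψ x • G₂ pr.1 x (u₂ pr.1 x)⟫) ∂(μI.prod μI)) := integral_neg _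
    have eY5 : ∫ pr : ℝ × ℝ, ν * ((φ n).normed volume (pr.2 - pr.1) * (∫ x in K, ⟪χ pr.2 • u₁ pr.2 x, G₂ pr.1 x (gradient ψ x)⟫) + ∑ i, (φ n).normed volume (pr.2 - pr.1) * (∫ x in K, ⟪χ pr.2 • G₁ pr.2 x (ψ x • e i), G₂ pr.1 x (e i)⟫)) ∂(μI.prod μI) =
        ν * ∫ pr : ℝ × ℝ, ((φ n).normed volume (pr.2 - pr.1) * (∫ x in K, ⟪χ pr.2 • u₁ pr.2 x, G₂ pr.1 x (gradient ψ x)⟫) + ∑ i, (φ n).normed volume (pr.2 - pr.1) * (∫ x in K, ⟪χ pr.2 • G₁ pr.2 x (ψ x • e i), G₂ pr.1 x (e i)⟫)) ∂(μI.prod μI) := integral_const_mul _ _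
    have eY6 : ∫ pr : ℝ × ℝ, ((φ n).normed volume (pr.2 - pr.1) * (∫ x in K, ⟪χ pr.2 • u₁ pr.2 x, G₂ pr.1 x (gradient ψ x)⟫) + ∑ i, (φ n).normed volume (pr.2 - pr.1) * (∫ x in K, ⟪χ pr.2 • G₁ pr.2 x (ψ x • e i), G₂ pr.1 x (e i)⟫)) ∂(μI.prod μI) =
        (∫ pr, (φ n).normed volume (pr.2 - pr.1) * (∫ x in K, ⟪χ pr.2 • u₁ pr.2 x, G₂ pr.1 x (gradient ψ x)⟫) ∂(μI.prod μI)) + ∫ pr : ℝ × ℝ, ∑ i, (φ n).normed volume (pr.2 - pr.1) * (∫ x in K, ⟪χ pr.2 • G₁ pr.2 x (ψ x • e i), G₂ pr.1 x (e i)⟫) ∂(μI.prod μI) := integral_add i9 i5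
    rw [e0, eXY, eX1, eX2, eX3, eX4, eX5, eX6, eX7, eY1, eY2, eY3, eY5, eY6, eX7]
  -- ### the limit of the decomposition
  have hlim := (((P1.1.add P2.1).neg.add P3.1).sub ((P4.1.add (tendsto_finsetSum (Finset.univ)
      fun i _ => (P5 i).1)).const_mul ν)).add
    ((hI.neg.add P8.1).sub ((P9.1.add (tendsto_finsetSum (Finset.univ) fun i _ => (P5 i).1)).const_mul ν))
  have hlim' := hlim.congr (fun n => (hdec n).symm)
  refine hlim'.trans (le_of_eq ?_)
  congr 1
  -- ### the diagonal: identification of the limit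
  have dx1 := ae_integrable_inner_diag (μ := volume) ha1 hu₂m 2 2 f_a1 f_u2_2
  have dx2 := ae_integrable_inner_diag (μ := volume) ha2 hu₂m (ENNReal.ofReal (6 / 5)) 6 f_a2 f_u2_6
  have dx4 := ae_integrable_inner_diag (μ := volume) ha4 hu₂m 2 2 f_a4 f_u2_2
  have dx5 := fun i => ae_integrable_inner_diag (μ := volume) (ha5 i).1 (hb5 i).1 2 2 (f_a5 i) (f_b5 i)
  have dxg3 := ae_integrable_inner_diag (μ := volume) hu₁m hb9 2 2 f_u1_2 f_b9
  have hdiag_pt : ∀ᵐ s ∂μI, χ s *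
        ((((-∫ x, ⟪G₁ s x (u₁ s x), ψ x • u₂ s x⟫) + ∫ x, p₁ s x * fderiv ℝ ψ x (u₂ s x)) -
          ν * ∫ x, ∑ i, ⟪G₁ s x (stdOrthonormalBasis ℝ (EuclideanSpace ℝ (Fin 3)) i),
            fderiv ℝ ψ x (stdOrthonormalBasis ℝ (EuclideanSpace ℝ (Fin 3)) i) • u₂ s x + ψ x • G₂ s x (stdOrthonormalBasis ℝ (EuclideanSpace ℝ (Fin 3)) i)⟫) +
         (((-∫ x, ⟪G₂ s x (u₂ s x), ψ x • u₁ s x⟫) + ∫ x, p₂ s x * fderiv ℝ ψ x (u₁ s x)) -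
          ν * ∫ x, ∑ i, ⟪G₂ s x (stdOrthonormalBasis ℝ (EuclideanSpace ℝ (Fin 3)) i),
            fderiv ℝ ψ x (stdOrthonormalBasis ℝ (EuclideanSpace ℝ (Fin 3)) i) • u₁ s x + ψ x • G₁ s x (stdOrthonormalBasis ℝ (EuclideanSpace ℝ (Fin 3)) i)⟫)) =
      (((-((∫ x in K, ⟪(χ s * ψ x) • G₁ s x (u₃ s x), u₂ s x⟫) + (∫ x in K, ⟪(χ s * ψ x) • G₁ s x (u₁ s x - u₃ s x), u₂ s x⟫))) + (∫ x in K, ⟪(χ s * p₁ s x) • gradient ψ x, u₂ s x⟫)) - ν * ((∫ x in K, ⟪χ s • G₁ s x (gradient ψ x), u₂ s x⟫) + ∑ i, (∫ x in K, ⟪χ s • G₁ s x (ψ x • e i), G₂ s x (e i)⟫))) +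
      (((-((∫ x in K, ⟪θ s • G₂ s x (u₂ s x), χ s • (ψ x • u₃ s x)⟫) + (∫ x in K, ⟪θ s • G₂ s x (u₂ s x), χ s • (ψ x • (u₁ s x - u₃ s x))⟫))) + (∫ x in K, ⟪χ s • u₁ s x, p₂ s x • gradient ψ x⟫)) - ν * ((∫ x in K, ⟪χ s • u₁ s x, G₂ s x (gradient ψ x)⟫) + ∑ i, (∫ x in K, ⟪χ s • G₁ s x (ψ x • e i), G₂ s x (e i)⟫))) := by
    filter_upwards [dx1, dx2, dx4, ae_all_iff.2 dx5, dxg3, P6.2.2.2.2, P7.2.2.2.2] with s i1 i2 i4 i5 ig3 i6 i7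
    rw [cross_density_f_eq ν i1 i2 i4 i5, cross_density_g_eq ν ig3 i5]
    have eW1 : (∫ x in K, ⟪(χ s * ψ x) • G₁ s x (u₃ s x), u₂ s x⟫) = χ s * ∫ x in K, ⟪ψ x • G₁ s x (u₃ s x), u₂ s x⟫ := by
      rw [const_mul_integral_inner]
      refine integral_congr_ae (Eventually.of_forall fun x => ?_); simp only [smul_smul]
    have eW2 : (∫ x in K, ⟪(χ s * ψ x) • G₁ s x (u₁ s x - u₃ s x), u₂ s x⟫) = χ s * ∫ x in K, ⟪ψ x • G₁ s x (u₁ s x - u₃ s x), u₂ s x⟫ := by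
      rw [const_mul_integral_inner]
      refine integral_congr_ae (Eventually.of_forall fun x => ?_); simp only [smul_smul]
    have eW3 : (∫ x in K, ⟪(χ s * p₁ s x) • gradient ψ x, u₂ s x⟫) = χ s * ∫ x in K, ⟪p₁ s x • gradient ψ x, u₂ s x⟫ := by
      rw [const_mul_integral_inner]
      refine integral_congr_ae (Eventually.of_forall fun x => ?_); simp only [smul_smul]
    have eW4 : (∫ x in K, ⟪χ s • G₁ s x (gradient ψ x), u₂ s x⟫) = χ s * ∫ x in K, ⟪G₁ s x (gradient ψ x), u₂ s x⟫ := by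
      rw [const_mul_integral_inner]
    have eW5 : ∀ i, (∫ x in K, ⟪χ s • G₁ s x (ψ x • e i), G₂ s x (e i)⟫) = χ s * ∫ x in K, ⟪G₁ s x (ψ x • e i), G₂ s x (e i)⟫ := fun i => by
      rw [const_mul_integral_inner]
    have eW8 : (∫ x in K, ⟪χ s • u₁ s x, p₂ s x • gradient ψ x⟫) = χ s * ∫ x in K, ⟪u₁ s x, p₂ s x • gradient ψ x⟫ := by
      rw [const_mul_integral_inner]
    have eW9 : (∫ x in K, ⟪χ s • u₁ s x, G₂ s x (gradient ψ x)⟫) = χ s * ∫ x in K, ⟪u₁ s x, G₂ s x (gradient ψ x)⟫ := by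
      rw [const_mul_integral_inner]
    have eW67 : (∫ x in K, ⟪θ s • G₂ s x (u₂ s x), χ s • (ψ x • u₃ s x)⟫) + (∫ x in K, ⟪θ s • G₂ s x (u₂ s x), χ s • (ψ x • (u₁ s x - u₃ s x))⟫) =
        χ s * ∫ x in K, ⟪u₁ s x, ψ x • G₂ s x (u₂ s x)⟫ := by
      rw [← integral_add i6 i7]
      by_cases hχs : χ s = 0
      · simp [hχs]
      · have hsI : s ∈ Icc δ (T - δ) := by
          by_contra h; exact hχs (hχ0 s h)
        have hθ1 : θ s = 1 := hθS s ⟨by linarith [hsI.1], by linarith [hsI.2]⟩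
        rw [const_mul_integral_inner]
        refine integral_congr_ae (Eventually.of_forall fun x => ?_)
        simp only
        rw [hθ1, one_smul, ← inner_add_right, ← smul_add, ← smul_add, add_sub_cancel]
        simp only [real_inner_smul_left, real_inner_smul_right]
        rw [real_inner_comm (u₁ s x) (G₂ s x (u₂ s x))]
        ring
    rw [eW1, eW2, eW3, eW4, eW67, eW8, eW9]
    simp_rw [eW5]
    rw [← Finset.mul_sum]
    ring
  -- integrability on the diagonal
  have J1 : Integrable (fun s => (∫ x in K, ⟪(χ s * ψ x) • G₁ s x (u₃ s x), u₂ s x⟫)) μI := P1.2.2.1.integral_prod_left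
  have J2 : Integrable (fun s => (∫ x in K, ⟪(χ s * ψ x) • G₁ s x (u₁ s x - u₃ s x), u₂ s x⟫)) μI := P2.2.2.1.integral_prod_left
  have J3 : Integrable (fun s => (∫ x in K, ⟪(χ s * p₁ s x) • gradient ψ x, u₂ s x⟫)) μI := P3.2.2.1.integral_prod_left
  have J4 : Integrable (fun s => (∫ x in K, ⟪χ s • G₁ s x (gradient ψ x), u₂ s x⟫)) μI := P4.2.2.1.integral_prod_left
  have J5 : ∀ i, Integrable (fun s => (∫ x in K, ⟪χ s • G₁ s x (ψ x • e i), G₂ s x (e i)⟫)) μI := fun i => (P5 i).2.2.1.integral_prod_left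
  have J6 : Integrable (fun s => (∫ x in K, ⟪θ s • G₂ s x (u₂ s x), χ s • (ψ x • u₃ s x)⟫)) μI := P6.2.2.1.integral_prod_left
  have J7 : Integrable (fun s => (∫ x in K, ⟪θ s • G₂ s x (u₂ s x), χ s • (ψ x • (u₁ s x - u₃ s x))⟫)) μI := P7.2.2.1.integral_prod_left
  have J8 : Integrable (fun s => (∫ x in K, ⟪χ s • u₁ s x, p₂ s x • gradient ψ x⟫)) μI := P8.2.2.1.integral_prod_left
  have J9 : Integrable (fun s => (∫ x in K, ⟪χ s • u₁ s x, G₂ s x (gradient ψ x)⟫)) μI := P9.2.2.1.integral_prod_left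
  have J5s : Integrable (fun s => ∑ i, (∫ x in K, ⟪χ s • G₁ s x (ψ x • e i), G₂ s x (e i)⟫)) μI := integrable_finsetSum _ fun i _ => J5 i
  have J12 : Integrable (fun s => -((∫ x in K, ⟪(χ s * ψ x) • G₁ s x (u₃ s x), u₂ s x⟫) + (∫ x in K, ⟪(χ s * ψ x) • G₁ s x (u₁ s x - u₃ s x), u₂ s x⟫))) μI := (J1.add J2).neg
  have J123 : Integrable (fun s => (-((∫ x in K, ⟪(χ s * ψ x) • G₁ s x (u₃ s x), u₂ s x⟫) + (∫ x in K, ⟪(χ s * ψ x) • G₁ s x (u₁ s x - u₃ s x), u₂ s x⟫))) + (∫ x in K, ⟪(χ s * p₁ s x) • gradient ψ x, u₂ s x⟫)) μI := J12.add J3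
  have J45 : Integrable (fun s => ν * ((∫ x in K, ⟪χ s • G₁ s x (gradient ψ x), u₂ s x⟫) + ∑ i, (∫ x in K, ⟪χ s • G₁ s x (ψ x • e i), G₂ s x (e i)⟫))) μI := (J4.add J5s).const_mul ν
  have JX : Integrable (fun s => ((-((∫ x in K, ⟪(χ s * ψ x) • G₁ s x (u₃ s x), u₂ s x⟫) + (∫ x in K, ⟪(χ s * ψ x) • G₁ s x (u₁ s x - u₃ s x), u₂ s x⟫))) + (∫ x in K, ⟪(χ s * p₁ s x) • gradient ψ x, u₂ s x⟫)) - ν * ((∫ x in K, ⟪χ s • G₁ s x (gradient ψ x), u₂ s x⟫) + ∑ i, (∫ x in K, ⟪χ s • G₁ s x (ψ x • e i), G₂ s x (e i)⟫))) μI := J123.sub J45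
  have J67 : Integrable (fun s => -((∫ x in K, ⟪θ s • G₂ s x (u₂ s x), χ s • (ψ x • u₃ s x)⟫) + (∫ x in K, ⟪θ s • G₂ s x (u₂ s x), χ s • (ψ x • (u₁ s x - u₃ s x))⟫))) μI := (J6.add J7).neg
  have J678 : Integrable (fun s => (-((∫ x in K, ⟪θ s • G₂ s x (u₂ s x), χ s • (ψ x • u₃ s x)⟫) + (∫ x in K, ⟪θ s • G₂ s x (u₂ s x), χ s • (ψ x • (u₁ s x - u₃ s x))⟫))) + (∫ x in K, ⟪χ s • u₁ s x, p₂ s x • gradient ψ x⟫)) μI := J67.add J8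
  have J95 : Integrable (fun s => ν * ((∫ x in K, ⟪χ s • u₁ s x, G₂ s x (gradient ψ x)⟫) + ∑ i, (∫ x in K, ⟪χ s • G₁ s x (ψ x • e i), G₂ s x (e i)⟫))) μI := (J9.add J5s).const_mul ν
  have JY : Integrable (fun s => ((-((∫ x in K, ⟪θ s • G₂ s x (u₂ s x), χ s • (ψ x • u₃ s x)⟫) + (∫ x in K, ⟪θ s • G₂ s x (u₂ s x), χ s • (ψ x • (u₁ s x - u₃ s x))⟫))) + (∫ x in K, ⟪χ s • u₁ s x, p₂ s x • gradient ψ x⟫)) - ν * ((∫ x in K, ⟪χ s • u₁ s x, G₂ s x (gradient ψ x)⟫) + ∑ i, (∫ x in K, ⟪χ s • G₁ s x (ψ x • e i), G₂ s x (e i)⟫))) μI := J678.sub J95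
  -- the diagonal integrals as iterated integrals
  have d1 : (∫ z, ⟪(χ z.1 * ψ z.2) • G₁ z.1 z.2 (u₃ z.1 z.2), u₂ z.1 z.2⟫ ∂(μI.prod μK)) = (∫ s, (∫ x in K, ⟪(χ s * ψ x) • G₁ s x (u₃ s x), u₂ s x⟫) ∂μI) := integral_prod _ P1.2.2.1
  have d2 : (∫ z, ⟪(χ z.1 * ψ z.2) • G₁ z.1 z.2 (u₁ z.1 z.2 - u₃ z.1 z.2), u₂ z.1 z.2⟫ ∂(μI.prod μK)) = (∫ s, (∫ x in K, ⟪(χ s * ψ x) • G₁ s x (u₁ s x - u₃ s x), u₂ s x⟫) ∂μI) := integral_prod _ P2.2.2.1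
  have d3 : (∫ z, ⟪(χ z.1 * p₁ z.1 z.2) • gradient ψ z.2, u₂ z.1 z.2⟫ ∂(μI.prod μK)) = (∫ s, (∫ x in K, ⟪(χ s * p₁ s x) • gradient ψ x, u₂ s x⟫) ∂μI) := integral_prod _ P3.2.2.1
  have d4 : (∫ z, ⟪χ z.1 • G₁ z.1 z.2 (gradient ψ z.2), u₂ z.1 z.2⟫ ∂(μI.prod μK)) = (∫ s, (∫ x in K, ⟪χ s • G₁ s x (gradient ψ x), u₂ s x⟫) ∂μI) := integral_prod _ P4.2.2.1
  have d5 : ∀ i, (∫ z, ⟪χ z.1 • G₁ z.1 z.2 (ψ z.2 • e i), G₂ z.1 z.2 (e i)⟫ ∂(μI.prod μK)) = (∫ s, (∫ x in K, ⟪χ s • G₁ s x (ψ x • e i), G₂ s x (e i)⟫) ∂μI) := fun i => integral_prod _ (P5 i).2.2.1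
  have d6 : (∫ z, ⟪θ z.1 • G₂ z.1 z.2 (u₂ z.1 z.2), χ z.1 • (ψ z.2 • u₃ z.1 z.2)⟫ ∂(μI.prod μK)) = (∫ s, (∫ x in K, ⟪θ s • G₂ s x (u₂ s x), χ s • (ψ x • u₃ s x)⟫) ∂μI) := integral_prod _ P6.2.2.1
  have d7 : (∫ z, ⟪θ z.1 • G₂ z.1 z.2 (u₂ z.1 z.2), χ z.1 • (ψ z.2 • (u₁ z.1 z.2 - u₃ z.1 z.2))⟫ ∂(μI.prod μK)) = (∫ s, (∫ x in K, ⟪θ s • G₂ s x (u₂ s x), χ s • (ψ x • (u₁ s x - u₃ s x))⟫) ∂μI) := integral_prod _ P7.2.2.1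
  have d8 : (∫ z, ⟪χ z.1 • u₁ z.1 z.2, p₂ z.1 z.2 • gradient ψ z.2⟫ ∂(μI.prod μK)) = (∫ s, (∫ x in K, ⟪χ s • u₁ s x, p₂ s x • gradient ψ x⟫) ∂μI) := integral_prod _ P8.2.2.1
  have d9 : (∫ z, ⟪χ z.1 • u₁ z.1 z.2, G₂ z.1 z.2 (gradient ψ z.2)⟫ ∂(μI.prod μK)) = (∫ s, (∫ x in K, ⟪χ s • u₁ s x, G₂ s x (gradient ψ x)⟫) ∂μI) := integral_prod _ P9.2.2.1
  have key : ∫ s, χ s *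
        ((((-∫ x, ⟪G₁ s x (u₁ s x), ψ x • u₂ s x⟫) + ∫ x, p₁ s x * fderiv ℝ ψ x (u₂ s x)) -
          ν * ∫ x, ∑ i, ⟪G₁ s x (stdOrthonormalBasis ℝ (EuclideanSpace ℝ (Fin 3)) i),
            fderiv ℝ ψ x (stdOrthonormalBasis ℝ (EuclideanSpace ℝ (Fin 3)) i) • u₂ s x + ψ x • G₂ s x (stdOrthonormalBasis ℝ (EuclideanSpace ℝ (Fin 3)) i)⟫) +
         (((-∫ x, ⟪G₂ s x (u₂ s x), ψ x • u₁ s x⟫) + ∫ x, p₂ s x * fderiv ℝ ψ x (u₁ s x)) -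
          ν * ∫ x, ∑ i, ⟪G₂ s x (stdOrthonormalBasis ℝ (EuclideanSpace ℝ (Fin 3)) i),
            fderiv ℝ ψ x (stdOrthonormalBasis ℝ (EuclideanSpace ℝ (Fin 3)) i) • u₁ s x + ψ x • G₁ s x (stdOrthonormalBasis ℝ (EuclideanSpace ℝ (Fin 3)) i)⟫)) ∂μI =
      (((-((∫ z, ⟪(χ z.1 * ψ z.2) • G₁ z.1 z.2 (u₃ z.1 z.2), u₂ z.1 z.2⟫ ∂(μI.prod μK)) + (∫ z, ⟪(χ z.1 * ψ z.2) • G₁ z.1 z.2 (u₁ z.1 z.2 - u₃ z.1 z.2), u₂ z.1 z.2⟫ ∂(μI.prod μK)))) + (∫ z, ⟪(χ z.1 * p₁ z.1 z.2) • gradient ψ z.2, u₂ z.1 z.2⟫ ∂(μI.prod μK))) - ν * ((∫ z, ⟪χ z.1 • G₁ z.1 z.2 (gradient ψ z.2), u₂ z.1 z.2⟫ ∂(μI.prod μK)) + ∑ i, (∫ z, ⟪χ z.1 • G₁ z.1 z.2 (ψ z.2 • e i), G₂ z.1 z.2 (e i)⟫ ∂(μI.prod μK)))) +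
      (((-((∫ z, ⟪θ z.1 • G₂ z.1 z.2 (u₂ z.1 z.2), χ z.1 • (ψ z.2 • u₃ z.1 z.2)⟫ ∂(μI.prod μK)) + (∫ z, ⟪θ z.1 • G₂ z.1 z.2 (u₂ z.1 z.2), χ z.1 • (ψ z.2 • (u₁ z.1 z.2 - u₃ z.1 z.2))⟫ ∂(μI.prod μK)))) + (∫ z, ⟪χ z.1 • u₁ z.1 z.2, p₂ z.1 z.2 • gradient ψ z.2⟫ ∂(μI.prod μK))) - ν * ((∫ z, ⟪χ z.1 • u₁ z.1 z.2, G₂ z.1 z.2 (gradient ψ z.2)⟫ ∂(μI.prod μK)) + ∑ i, (∫ z, ⟪χ z.1 • G₁ z.1 z.2 (ψ z.2 • e i), G₂ z.1 z.2 (e i)⟫ ∂(μI.prod μK)))) := by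
    rw [integral_congr_ae hdiag_pt, integral_add JX JY, integral_sub J123 J45, integral_add J12 J3, integral_neg,
      integral_add J1 J2, integral_const_mul, integral_add J4 J5s, integral_finsetSum _ (fun i _ => J5 i),
      integral_sub J678 J95, integral_add J67 J8, integral_neg, integral_add J6 J7, integral_const_mul,
      integral_add J9 J5s, integral_finsetSum _ (fun i _ => J5 i), d1, d2, d3, d4, d6, d7, d8, d9]
    simp_rw [d5]
  exact key.symm

end Densities

end Literature.Analysis.FluidPDE
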